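import Literature.MathematicalPhysics.QuantumFieldTheory.Balaban1983to89.B6MemberOfCubeV1L0
import Literature.MathematicalPhysics.QuantumFieldTheory.Balaban1983to89.B6FullWindowReachV1L0
import Literature.MathematicalPhysics.QuantumFieldTheory.Balaban1983to89.B6Partition118KLevelTorusWindowL0
import Literature.MathematicalPhysics.QuantumFieldTheory.Balaban1983to89.B6TranslateTorusV1L0
import Literature.MathematicalPhysics.QuantumFieldTheory.Balaban1983to89.B6Prop26KLevelSkeletonV1L0
import Literature.MathematicalPhysics.QuantumFieldTheory.Balaban1983to89.B6Cover236MultiLevelTorusReachL0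
import Literature.MathematicalPhysics.QuantumFieldTheory.Balaban1983to89.B6Cover236MultiLevelBlocksL0
import Literature.MathematicalPhysics.QuantumFieldTheory.Balaban1983to89.B6Geom246MultiLevelBoxL0
import Literature.MathematicalPhysics.QuantumFieldTheory.Balaban1983to89.B6Geom246MultiLevelTorusL0
import Literature.MathematicalPhysics.QuantumFieldTheory.Balaban1983to89.B6GlobalChartV1L0
import Literature.MathematicalPhysics.QuantumFieldTheory.Balaban1983to89.B6MultiLevelTorusOperatorL0
import Literature.MathematicalPhysics.QuantumFieldTheory.Balaban1983to89.B6Partition118KLevelFineL0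
import Literature.MathematicalPhysics.QuantumFieldTheory.Balaban1983to89.B6Partition118KLevelTorusCentralL0
import Literature.MathematicalPhysics.QuantumFieldTheory.Balaban1983to89.B6CubeWindowV1
/-!
# `Balaban1983to89.B6CubeWindowV1L0` — LEVEL-0 TWIN (programme G-F3′-L0, director-ym LINE №27 / UV3-NODE §24.5; plan `lit-balaban-r03/G-F3L0-PLAN.md`) of `B6CubeWindowV1`:
the same declarations, SAME NAMES AND STATEMENTS, for nested families WITH print's region `Λ₀ = T ∖ Ω₁` ADMITTED (structures
`B6MultiLevelBoxOperatorL0.Domains` / `B6MultiLevelTorusOperatorL0.TDomains`: levels `0, …, k`, the level-`0` block a single site, `Q′₀ = id`,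
finite weight `a₀` — print p.225 (2.14) «Σ_{j=0}^k … (Q′₀λ)(x) = λ(x), x ∈ Λ₀», p.229 «taking a sequence (2.1) … smallest possible domains B^j(Λ_j),
and considering the operator Δ_a defined by (2.19), (2.20) for this sequence»).  Every `D`-free object is the lineage's, consumed BY NAME; no existing
module is touched; no fact is minted.  Unit `lit-balaban-r03` (B6 fold owner, r03 gen 36); referee ref-4.  THE TWIN'S DOCUMENTATION FOLLOWS
VERBATIM (its «levels 1 … k» / «Ω₁ = X» sentences describe the twin; here `j` runs from `0` and `Ω₁` may be a proper subset).

# `Balaban1983to89.B6CubeWindowV1` — T. Bałaban, *Propagators and renormalization transformations for lattice gauge theories. II*,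
# Commun. Math. Phys. **96** (1984) 223–250 [Balaban1984PropagatorsII], p. 238 («we take the cube □̃³ and identify it with a torus T_□»),
# (2.89)–(2.94) p. 239, (2.133) p. 247, Prop. 2.6 (2.136) p. 247: THE WINDOW AND THE MEMBER `t(□)` OF EVERY CUBE OF THE k-LEVEL COVER ON THE
# V1 TORUS, ITS OPERATORS `G_□, M_□, P_□` ON THE GLOBAL LATTICE, AND THE k-LEVEL (2.136)₁ WITH (2.133), (hagree), (hinvl) DISCHARGED
# (B6-CLOSURE §5 item 13, ROUTE V, steps (iii) + (iv))

statement-level skeleton of published theorems with citation tags; proofs where landed; nothing here is a claim about the Yang–Mills mass gap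

PDF held: `paper:balaban1984-cmp96-propagators-rt-ii` (journal page = PDF page + 222): p. 238 [PDF 16] (*"Let us consider the term h_□Δ_a h_□ …
we take the cube □̃³ and identify it with a torus T_□ … the operators … are defined on T_□ as in (2.19)"*), p. 239 [PDF 17] ((2.89)–(2.94): *"B^j(Λ′) =
□̃² ∩ B^{j+1}(Λ_{j+1})"*, *"G₀ = Σ_{□∈𝒟} h_□G_□h_□"*, the rescaling (2.94)), p. 247 [PDF 25] ((2.133)–(2.136)).

CITATION HEADER (lean-in-tree rule) — WHAT IS REPRODUCED.  Phase-2 file of the `lit-balaban` typed skeleton (HOME `run/shared/lean/pub/lit-balaban/`),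
seat **r03 gen 20** (row owner of B6.Prop2.6); SKELETON rows **B6.Prop2.6** × **B6.Eq2.133** × **B6.Eq2.91** × B6.Eq2.36 × B6.Eq2.2 (cells).  The k-level
assembly skeleton `…B6Prop26KLevelSkeletonV1L0.prop26_2136_kLevel_skeleton` (p352303) displays, per cube `□` of p21's cover, abstract member operators
`G_□, M_□, P_□` with three ring/majorant hypotheses (h2133), (hagree), (hinvl).  THIS FILE CONSTRUCTS THE MEMBERS AND DISCHARGES THE THREE:
* §1–§2 **the window of the cube** `□ = (j, β)`: in p38's canonical chart `s_□ = svec` (central cube `cc`, centre `ctr = (qc + ½)·S_j`, `S_j = M_h·L^{j+1}`),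
  with `M_h = L^a`, the member exponent `e(j) = a + j + 2` (`L^{e} = L·S_j`: member period `2L·S_j`, half-window `L·S_j`) and the corner
  **`x0 □ = S_j·(qc − ℓ/2) = ctr − L·S_j/2`** (`S_j ∣ x₀`, `L^i ∣ x₀` for `i ≤ j + 1`; `x₀ ≥ 0` and `x₀ + 2L·S_j ≤ N₀` under the PLACEMENT `Placed`:
  `ℓ/2 ≤ qc_μ`, `qc_μ − ℓ/2 + 2L ≤ L^{k−j}·P′_μ` — automatic below the top level, `placed_of_lt`; `placed_top` for `L ≤ 5`); the window against the
  ball around the centre: `deep_of_dist_le` (`|x − ctr| + r ≤ L·S_j/2 ⇒` `r`-deep), `dist_le_of_deep` (window ⊂ `3L·S_j/2`-ball), `dist_le_of_inWindow`,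
  `inWindow_of_dist_lt` (the lower half-window is the open `L·S_j/2`-ball);
* §3 **the member scale** `j0 □ := min(jmin, k − 1)`, `jmin` = the least chart level met by the `3L·S_j/2`-ball (`levSet`, attained: `jmin_mem`); with
  p38's `two_level_ball` (`R ≥ 2L²`): **`two_level`** — every site of the ball has level `j₀` or `j₀ + 1`; `1 ≤ j₀`, `j₀ + 1 ≤ k` (`k ≥ 2`), `j₀ ≤ j ≤ j₀ + 1`,
  `j0_dichotomy` (either `j₀` is attained in the ball or the ball sees only the top level);
* §4 **the member's geometric inputs**: `hlev_deep`/`hlev_window` (two-level window), **`hfar_cube`** ((2.2) on the torus against a level-`j₀` site of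
  the ball: no `n`-block adjacent to a deep window block lies in `Ω_n`, `j₀ + 2 ≤ n ≤ k`; `hfar_of_sepT_le` is `B6MemberOfCubeV1L0.hfar_of_sepT` with
  `lev x₁ ≤ j`), the chart-frame `h_□` **`hch`** `= h^F_{cc}(b₋)` with `hch_deep` (`supp h_□` is `4L^{j₀+1}`-deep, `M_h ≥ 8`), and the reach:
  `inWindow_of_blk_mem_Q` (bonds whose chart block lies in `□⁺ = Q` are in the lower half-window), `j0_le_of_mem_Q` (blocks of `□⁺` have level `≥ j₀`);
* §5 **the member** `tC := B6MemberOfCubeV1L0.tOf hN (D.chart s_□) hk wc c′ (e(j)) 0 (j₀) … (x₀)` (chart-frame weights `wc`), the unit `sc = (c′/L^{j₀})²` and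
  the CHART-FRAME operators **`GlC := sc⁻¹ • GlV1 …`** (full window), **`MlC := sc • ε(Δ_□ + Q*a_□Q)ρ`**, **`PlC := sc • ε(∂P_□∂*)ρ`**; there:
  **`hagreeC`** (= `hagree_tOf` with this file's `hlev`/`hfar`/support; the weight band `hband` of `wc` near the window displayed), **`hinvlC`**
  (`B6FullWindowReachV1.hinvl_GlV1_scaled`), **`h2133C`** (a local majorant `C·e^{−σd_T}` of the full-window transplant on `□⁺` gives
  `C·(L^{j(y)}/c′)²·e^{−σd_T}` for `GlC` — PRINT'S PREFACTOR `(L^jη)²` of (2.136), from `sc⁻¹ ≤ (L^{j(y)}/c′)²` on `□⁺`);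
* §6 **the global members** **`Gl`/`Ml`/`Pl := τ_{−v}·(GlC/MlC/PlC with wc := w ∘ idxB)·τ_v`**, `v = (M·L^k)·s_□` (`B6TranslateTorusV1`): `trV_hB`
  (the skeleton's `hB` translated is `hch`, p38's `hT_eq_hF_cc`), **`hagree_cube`**, **`hinvl_cube`**, **`h2133_cube`** (on the skeleton's `ST = Q^T_□`,
  `localMajorant_conj_chart` + `kernel_blkMap`; `mem_blkMap_image_SQ`: `Q^T_□` is the block-map image of `□⁺`);
* §7 **`prop26_2136_kLevel_cubes`**: `∃ δ > 0, A ≥ 0` (of `B6FullWindowReachV1L0.reach2133_G_V1_full`, on `d, L, a₀, a₁`) such that for every V1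
  global torus with `k ≥ 2`, `M_h = L^a ≥ 8`, `R ≥ 2L²`, `P′ ≥ 5`, all cubes placed, the weight band, an overlap bound `Nov`, and (2.134) + output
  localisation + smallness FOR THE (2.91)-FAMILY OF THESE MEMBERS, the genuine `G = GE (domT hN D hk)` has the majorant
  `(Nov·A)·c₁·(1 − Nov²θ₀c₁)⁻¹·(L^{j(y)}/c′)²·e^{−δ₃d_T}` — the skeleton with (h2133)/(hagree)/(hinvl) DISCHARGED;
* §8 (v1.1) **the weight band**: `GlobalBand b₀ b₁ c′ w` (`w(i)/(c′/L^{n(i)})² ∈ [b₀, b₁]·(L^{n(i)})^{d+1}` for every index bond, print's (2.16)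
  weights in the units of `c′`) gives the chart-frame member band of every cube with `[a₀, a₁] := [b₀/L, b₁L^d]` (`band_of_global`), hence
  **`prop26_2136_kLevel_cubes_band`** — the same conclusion with the GLOBAL band as hypothesis (per-cube `hband` DISCHARGED).
* §9 (v1.2) **the overlap number DISCHARGED**: `hNov_cover` (`Nov = 3·5^{d+1}`, p21's `B6Cover236MultiLevelTorusReachL0.card_filter_mem_QT_le`), `placed_all`
  (at `L = 5`, `P′ ≥ 12` the canonical chart places every cube), **`prop26_2136_kLevel_cubes_band_nov`** (the band theorem with `Nov` discharged).
No new definition of mathematical content beyond the window bookkeeping (`eC`, `x0`, `rho`, `levSet`, `jmin`, `j0`, `hch`, `Placed`, `tC`, `sc`,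
`GlC/MlC/PlC`, `SQ`, `wC`, `Gl/Ml/Pl`, `GlobalBand`); no new fact; standard axioms.  v1.0 p353585; v1.1 adds §8; v1.2 adds §9 (r03 gen 21).

## HONEST SCOPE / DIVERGENCES

(1) The member torus `T_□` has fine period `2L·S_j = 2L^{a+j+2}` (print: `□̃³`, a fixed multiple of `M L^j`) — the V1 tori have periods `2L^e`
only; the whole member torus is the window, the reach `□⁺` sits in its lower half (`B6Prop26ReachTransplant.InWindow`), so the member's torus distance
agrees with the global one on the reach.  `M_h = L^a` (the hypothesis `hN` forces `M_h ∈ {L^a, 2L^a}`; the second case is not treated).  (2) PLACEMENT: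
the canonical chart of p38's `…Central` puts the central cube at big-block index `2`; the window needs room `L·S_j/2` below the centre and `3L·S_j/2`
above — automatic for cubes of level `< k` (`placed_of_lt`, `P′ ≥ 5`), for TOP cubes only when `L ≤ 5` and `P′ ≥ 2L + 2` (`placed_top`); in general the
top cubes need a deeper central chart (index `ℓ/2`; asked of p38) — `Placed` stays a hypothesis of §7.  (3) DISPLAYED, NOT DISCHARGED: the weight band
`hband` (reduced in §8 to the global band `GlobalBand`, which is print's hypothesis (2.16) on the weights `a_j`; print (2.16)/(2.90): the weights of `Δ_a` on the `Λ_j`-bonds are `≍ (L^jη)`-powers; here: the chart-frame pull-back `w ∘ idxB` of the global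
weights, divided by `(c′/L^{j₀})²`, lies in `[a₀, a₁]·(L^{j₀})^{d+1}` on the index bonds of levels `j₀, j₀+1` near the window), the (2.134) majorant with
its output localisation and smallness for the (2.91)-family of THESE members (p38's `h2134_kFam_torus` with its per-cube inputs — in progress, p38 g27 /
p22 g20), the overlap bound `Nov` (p21 g17), the Lemma-2.1 budget.  (4) `k ≥ 2` (for `k = 1` the torus is one-level — [Balaban1984PropagatorsI]);
`M_h ≥ 8`, `R ≥ 2L²` are this file's (not print's) thresholds for the margins `4L^{j₀+1}` and the two-level ball of radius `3L·S_j/2`.  (5) Entries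
(2.136)₂₋₄, (2.137)–(2.140) untouched.  Value = the per-cube half of ROUTE V made concrete; NOT summit progress.  Unit `lit-balaban-r03` (gen 20), 2026-08-23.
-/

noncomputable section

open scoped BigOperators
open Finset

namespace Literature.MathematicalPhysics.QuantumFieldTheory.Balaban1983to89.B6CubeWindowV1L0

open LatticeFieldCalculus
open B4Reflection242 (boxDom mem_boxDom blk)
open B4ContourShift (supNorm)
open B6MultiLevelBoxOperator (N0 bigSide one_le_bigSide)
open B6MultiLevelTorusOperator (tshift N0_eq_bigSide_mul)
open B6MultiLevelTorusOperatorL0 (TDomains)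
open B6Eq238MultiLevelTorus (rj qc svec one_le_rj bigSide_k_eq)
open B6Cover236MultiLevelBlocksL0 (cubes ctr side wit lev_wit blk_wit dist_toR_ctr_le Q mem_Q window)
open B6Geom246MultiLevelBox (toR supNorm_eq_dist)
open B6Geom246MultiLevelBoxL0 (bset blkOf blkOf_val cen dist_toR_cen_le exists_blkOf_eq lev_eq_of_blkOf_eq)
open B6Partition118KLevelTorusCentral (qc_bounds_rj one_le_of_four_le pow_le_half_bigSide)
open B6Partition118KLevelTorusCentralL0 (Dch cc σch side_cc ctr_cc_bounds level_bounds hT_eq_hF_cc)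
open B6Partition118KLevelTorusWindowL0 (two_level_ball)
open B6Partition118KLevelFineL0 (hF dist_lt_of_hF_ne_zero)
open B6GlobalChartV1 (PV toBox toBox_apply)
open B6GlobalChartV1L0 (domT blkV1)
open B6AgreeLapV1Chart (DeepS DeepB deepS_mono)
open B6Prop25TwoScaleCensus (TSIdx)
open B6MemberOfCubeV1 (bare)
open Literature.MathematicalPhysics.QuantumFieldTheory.Balaban1983to89.B6CubeWindowV1 (eC pow_eC x0 bigSide_dvd_x0 pow_dvd_x0 two_dvd_ell half_ell_real bare_sites x0_nonneg x0_fit one_le_bigSide_real rho Placed placed_of_lt placed_top one_le_of_eight_le four_le_of_five_le GlobalBand band_le placed_all)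

variable {d ℓ : ℕ} {hd : 1 ≤ d + 1} {hL : Odd (ℓ + 1) ∧ 1 < ℓ + 1} {a₀ a₁ : ℝ} {m K : ℕ} {Mh k R : ℕ} {P' : Fin (d + 1) → ℕ}

/-! ## §1  The member size and the window corner of a cube: arithmetic -/

section Arith

/-- **`x₀ = ctr − L·S_j/2`** (real form). [cite: Balaban1984PropagatorsII, p.238, bookkeeping] -/
theorem x0_eq_ctr_sub (hL : Odd (ℓ + 1) ∧ 1 < ℓ + 1) {D : B6MultiLevelTorusOperatorL0.TDomains d ℓ Mh k P' R} (hMh1 : 1 ≤ Mh) (hP4 : ∀ μ, 4 ≤ P' μ)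
    (c : ↥(cubes D.toDomains)) (μ : Fin (d + 1)) :
    (x0 ℓ Mh k c.1 μ : ℝ) = ctr (Dch D c) (cc D hMh1 hP4 c) μ - ((ℓ : ℝ) + 1) * (bigSide ℓ Mh c.1.1 : ℝ) / 2 := by
  have ec : ctr (Dch D c) (cc D hMh1 hP4 c) μ = ((qc ℓ k c.1.1 c.1.2 μ : ℝ) + 1 / 2) * (bigSide ℓ Mh c.1.1 : ℝ) := rfl
  rw [ec]; unfold x0
  rw [Int.cast_mul, Int.cast_sub, half_ell_real hL, Int.cast_natCast]
  ring

end Arith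

/-! ## §2  The window against the ball around the centre of the central cube (chart coordinates) -/

section Geometry

variable (hN : ∀ μ, N0 ℓ Mh k P' μ = (PV d ℓ m K hd hL).sitesPerDir 0) {D : TDomains d ℓ Mh k P' R} (hMh1 : 1 ≤ Mh) (hP4 : ∀ μ, 4 ≤ P' μ)
  {a : ℕ} (hMha : Mh = (ℓ + 1) ^ a) (c : ↥(cubes D.toDomains))

include hMha in
/-- **A SITE WHOSE CHART IS WITHIN `L·S_j/2 − r` OF THE CENTRE IS `r`-DEEP IN THE WINDOW** (the window's lower half is the `L·S_j/2`-ball, the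
period is `2L·S_j`). [cite: Balaban1984PropagatorsII, p.238 (□ ⊂ □̃ ⊂ □̃² ⊂ □̃³ = T_□), dictionary] -/
theorem deep_of_dist_le {r : ℕ} {j₀ : ℕ} (hj : j₀ + 1 ≤ eC a c.1.1 + 0) (ha : a₀ ≤ a₁) {x : Site (PV d ℓ m K hd hL) 0}
    (hx : dist (toR (toBox hN x).1) (B6Cover236MultiLevelBlocksL0.ctr (Dch D c) (cc D hMh1 hP4 c)) + r ≤ ((ℓ : ℝ) + 1) * (bigSide ℓ Mh c.1.1 : ℝ) / 2) :
    x ∈ DeepS (bare d ℓ hd hL (eC a c.1.1) 0 j₀ hj ha) (x0 ℓ Mh k c.1) r := by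
  intro μ
  rw [bare_sites, pow_eC hMha]
  have hS := one_le_bigSide_real (ℓ := ℓ) hMh1 c.1.1
  have hμ : |toR (toBox hN x).1 μ - ctr (Dch D c) (cc D hMh1 hP4 c) μ| ≤ ((ℓ : ℝ) + 1) * (bigSide ℓ Mh c.1.1 : ℝ) / 2 - r := by
    have h := dist_le_pi_dist (toR (toBox hN x).1) (ctr (Dch D c) (cc D hMh1 hP4 c)) μ
    rw [Real.dist_eq] at h
    linarith
  rw [abs_le] at hμ
  have ex : toR (toBox hN x).1 μ = (((x μ).val : ℕ) : ℝ) := by simp [toR, toBox_apply]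
  rw [ex] at hμ
  have e0 := x0_eq_ctr_sub hL hMh1 hP4 c μ
  have hr0 : (0 : ℝ) ≤ r := Nat.cast_nonneg _
  obtain ⟨hμ1, hμ2⟩ := hμ
  have h1 : ((x0 ℓ Mh k c.1 μ + r : ℤ) : ℝ) ≤ ((((x μ).val : ℕ) : ℤ) : ℝ) := by push_cast; linarith
  have h2 : (((((x μ).val : ℕ) : ℤ) + r : ℤ) : ℝ) < ((x0 ℓ Mh k c.1 μ + ((2 * ((ℓ + 1) * bigSide ℓ Mh c.1.1) : ℕ) : ℤ) : ℤ) : ℝ) := by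
    push_cast; nlinarith
  exact ⟨Int.cast_le.1 h1, Int.cast_lt.1 h2⟩

include hMha in
/-- **EVERY WINDOW SITE IS WITHIN `3L·S_j/2` OF THE CENTRE**. [cite: Balaban1984PropagatorsII, p.238 (T_□ = □̃³), dictionary] -/
theorem dist_le_of_deep {j₀ : ℕ} (hj : j₀ + 1 ≤ eC a c.1.1 + 0) (ha : a₀ ≤ a₁) {x : Site (PV d ℓ m K hd hL) 0}
    (hx : x ∈ DeepS (bare d ℓ hd hL (eC a c.1.1) 0 j₀ hj ha) (x0 ℓ Mh k c.1) 0) :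
    dist (toR (toBox hN x).1) (B6Cover236MultiLevelBlocksL0.ctr (Dch D c) (cc D hMh1 hP4 c)) ≤ 3 * ((ℓ : ℝ) + 1) * (bigSide ℓ Mh c.1.1 : ℝ) / 2 := by
  have hS := one_le_bigSide_real (ℓ := ℓ) hMh1 c.1.1
  refine (dist_pi_le_iff (by positivity)).2 fun μ => ?_
  obtain ⟨h1, h2⟩ := hx μ
  rw [bare_sites, pow_eC hMha] at h2
  have e0 := x0_eq_ctr_sub hL hMh1 hP4 c μ
  have h1r : ((x0 ℓ Mh k c.1 μ : ℤ) : ℝ) ≤ (((x μ).val : ℕ) : ℝ) := by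
    have := (Int.cast_le (R := ℝ)).2 h1; push_cast at this; linarith
  have h2r : (((x μ).val : ℕ) : ℝ) < ((x0 ℓ Mh k c.1 μ : ℤ) : ℝ) + 2 * (((ℓ : ℝ) + 1) * (bigSide ℓ Mh c.1.1 : ℝ)) := by
    have := (Int.cast_lt (R := ℝ)).2 h2; push_cast at this; linarith
  rw [Real.dist_eq, abs_le]
  have ex : toR (toBox hN x).1 μ = (((x μ).val : ℕ) : ℝ) := by simp [toR, toBox_apply]
  rw [ex]
  constructor <;> linarith

include hMha in
/-- **EVERY POINT OF THE LOWER HALF-WINDOW `[x₀, x₀ + L·S_j)` IS WITHIN `L·S_j/2` OF THE CENTRE**. [cite: Balaban1984PropagatorsII, p.238, dictionary] -/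
theorem dist_le_of_inWindow (hL : Odd (ℓ + 1) ∧ 1 < ℓ + 1) {z : Fin (d + 1) → ℤ} (hz : ∀ μ, x0 ℓ Mh k c.1 μ ≤ z μ ∧ z μ < x0 ℓ Mh k c.1 μ + ((ℓ + 1) ^ eC a c.1.1 : ℕ)) :
    dist (toR z) (B6Cover236MultiLevelBlocksL0.ctr (Dch D c) (cc D hMh1 hP4 c)) ≤ ((ℓ : ℝ) + 1) * (bigSide ℓ Mh c.1.1 : ℝ) / 2 := by
  have hS := one_le_bigSide_real (ℓ := ℓ) hMh1 c.1.1
  refine (dist_pi_le_iff (by positivity)).2 fun μ => ?_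
  obtain ⟨h1, h2⟩ := hz μ
  rw [pow_eC hMha] at h2
  have e0 := x0_eq_ctr_sub hL hMh1 hP4 c μ
  have h1r : ((x0 ℓ Mh k c.1 μ : ℤ) : ℝ) ≤ (z μ : ℝ) := by exact_mod_cast h1
  have h2r : ((z μ : ℤ) : ℝ) < ((x0 ℓ Mh k c.1 μ + (((ℓ + 1) * bigSide ℓ Mh c.1.1 : ℕ) : ℤ) : ℤ) : ℝ) := by exact_mod_cast h2
  push_cast at h2r
  rw [Real.dist_eq, abs_le]
  show -(((ℓ : ℝ) + 1) * (bigSide ℓ Mh c.1.1 : ℝ) / 2) ≤ (z μ : ℝ) - _ ∧ (z μ : ℝ) - _ ≤ _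
  constructor <;> linarith

include hMha in
/-- **A POINT STRICTLY WITHIN `L·S_j/2` OF THE CENTRE LIES IN THE LOWER HALF-WINDOW**. [cite: Balaban1984PropagatorsII, p.238, dictionary] -/
theorem inWindow_of_dist_lt (hL : Odd (ℓ + 1) ∧ 1 < ℓ + 1) {z : Fin (d + 1) → ℤ} (hz : dist (toR z) (B6Cover236MultiLevelBlocksL0.ctr (Dch D c) (cc D hMh1 hP4 c)) < ((ℓ : ℝ) + 1) * (bigSide ℓ Mh c.1.1 : ℝ) / 2)
    (μ : Fin (d + 1)) : x0 ℓ Mh k c.1 μ ≤ z μ ∧ z μ < x0 ℓ Mh k c.1 μ + ((ℓ + 1) ^ eC a c.1.1 : ℕ) := by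
  rw [pow_eC hMha]
  have hμ := lt_of_le_of_lt (dist_le_pi_dist (toR z) (ctr (Dch D c) (cc D hMh1 hP4 c)) μ) hz
  rw [Real.dist_eq, abs_lt] at hμ
  have ex : toR z μ = (z μ : ℝ) := rfl
  rw [ex] at hμ
  have e0 := x0_eq_ctr_sub hL hMh1 hP4 c μ
  have h1 : ((x0 ℓ Mh k c.1 μ : ℤ) : ℝ) < (z μ : ℝ) := by linarith [hμ.1]
  have h2 : ((z μ : ℤ) : ℝ) < ((x0 ℓ Mh k c.1 μ + (((ℓ + 1) * bigSide ℓ Mh c.1.1 : ℕ) : ℤ) : ℤ) : ℝ) := by push_cast; linarith [hμ.2]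
  exact ⟨le_of_lt (Int.cast_lt.1 h1), Int.cast_lt.1 h2⟩

end Geometry

/-! ## §3  The member scale `j₀(□)`: the least level met by the `3L·S_j/2`-ball, clamped below `k`; the ball is two-level -/

section Levels

variable {D : TDomains d ℓ Mh k P' R} (hMh1 : 1 ≤ Mh) (hP4 : ∀ μ, 4 ≤ P' μ) (c : ↥(cubes D.toDomains))

/-- the set of levels met by the ball. [cite: Balaban1984PropagatorsII, (2.3)–(2.4) p.224, dictionary] -/
def levSet (hMh1 : 1 ≤ Mh) (hP4 : ∀ μ, 4 ≤ P' μ) (c : ↥(cubes D.toDomains)) : Set ℕ :=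
  {n | ∃ w : ↥(boxDom (N0 ℓ Mh k P')), dist (toR w.1) (ctr (Dch D c) (cc D hMh1 hP4 c)) ≤ rho ℓ Mh c.1.1 ∧ (Dch D c).lev w.1 = n}

/-- the cube's witness (a level-`j` site of the big block) lies in the ball. [cite: Balaban1984PropagatorsII, p.229 («with a center y ∈ Λ_j»), bookkeeping] -/
theorem wit_mem_ball : dist (toR (B6Cover236MultiLevelBlocksL0.wit (Dch D c) (cc D hMh1 hP4 c)).1) (ctr (Dch D c) (cc D hMh1 hP4 c)) ≤ rho ℓ Mh c.1.1 := by
  have h := dist_toR_ctr_le (Dch D c) hMh1 (blk_wit (Dch D c) (cc D hMh1 hP4 c))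
  rw [side_cc] at h
  have hS := one_le_bigSide_real (ℓ := ℓ) hMh1 c.1.1
  have hl : (0 : ℝ) ≤ ℓ := Nat.cast_nonneg _
  unfold rho; nlinarith

/-- the level `j` of the cube is met by the ball. [cite: Balaban1984PropagatorsII, (2.3)–(2.4) p.224, bookkeeping] -/
theorem level_mem_levSet : c.1.1 ∈ levSet hMh1 hP4 c := ⟨wit (Dch D c) (cc D hMh1 hP4 c), wit_mem_ball hMh1 hP4 c, lev_wit _ _⟩

/-- **THE LEAST LEVEL MET BY THE BALL** `jmin(□)`. [cite: Balaban1984PropagatorsII, p.230 («□ … intersecting maybe the domain B^{j+1}(Λ_{j+1})»), dictionary] -/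
def jmin (hMh1 : 1 ≤ Mh) (hP4 : ∀ μ, 4 ≤ P' μ) (c : ↥(cubes D.toDomains)) : ℕ := sInf (levSet hMh1 hP4 c)

/-- `jmin` is attained in the ball. [cite: Balaban1984PropagatorsII, p.230, bookkeeping] -/
theorem jmin_mem : jmin hMh1 hP4 c ∈ levSet hMh1 hP4 c := Nat.sInf_mem ⟨c.1.1, level_mem_levSet hMh1 hP4 c⟩

/-- `jmin` is a lower bound of the levels in the ball. [cite: Balaban1984PropagatorsII, p.230, bookkeeping] -/
theorem jmin_le {w : ↥(boxDom (N0 ℓ Mh k P'))} (hw : dist (toR w.1) (ctr (Dch D c) (cc D hMh1 hP4 c)) ≤ rho ℓ Mh c.1.1) :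
    jmin hMh1 hP4 c ≤ (Dch D c).lev w.1 := Nat.sInf_le ⟨w, hw, rfl⟩

/-- `jmin ≤ j`. [cite: Balaban1984PropagatorsII, p.230, bookkeeping] -/
theorem jmin_le_level : jmin hMh1 hP4 c ≤ c.1.1 := Nat.sInf_le (level_mem_levSet hMh1 hP4 c)

/-- `jmin ≤ k` (LEVEL-0 TWIN, JOINT J7: `jmin = 0` is possible — the ball of a low cube may meet `Λ₀`). [cite: Balaban1984PropagatorsII, (2.3)–(2.4) p.224, bookkeeping] -/
theorem jmin_bounds : jmin hMh1 hP4 c ≤ k := by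
  obtain ⟨w, _, hw⟩ := jmin_mem hMh1 hP4 c
  rw [← hw]
  exact (Dch D c).lev_le _

/-- **THE MEMBER SCALE** `j₀(□) := min(jmin(□), k − 1)` (the clamp serves the cubes whose ball sees only the top level). [cite: Balaban1984PropagatorsII, p.238 («□ connected with a L^{−j}-scale»), dictionary] -/
def j0 (hMh1 : 1 ≤ Mh) (hP4 : ∀ μ, 4 ≤ P' μ) (c : ↥(cubes D.toDomains)) : ℕ := min (jmin hMh1 hP4 c) (k - 1)

/- LEVEL-0 TWIN (JOINT J7): the lineage's `one_le_j0` (`1 ≤ j₀` for `k ≥ 2`) is NOT twinned — with `Λ₀ ≠ ∅` the member scale `j₀(□)` is `0`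
for the cubes whose ball meets `Λ₀`; the member is then the two-scale datum at scales `(0, 1)` (single-site blocks, `Q = id`, weights in `[a₀, a₁]`). -/

/-- `j₀ + 1 ≤ k` for `k ≥ 1`. [cite: Balaban1984PropagatorsII, p.238, bookkeeping] -/
theorem j0_succ_le (hk1 : 1 ≤ k) : j0 hMh1 hP4 c + 1 ≤ k := by unfold j0; omega

/-- `j₀ + 1 ≤ e(j) + 0` (the scale fits the member size). [cite: Balaban1984PropagatorsII, p.238, bookkeeping] -/
theorem j0_hj (a : ℕ) : j0 hMh1 hP4 c + 1 ≤ eC a c.1.1 + 0 := by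
  have h1 := jmin_le_level hMh1 hP4 c
  unfold j0 eC; omega

/-- **THE BALL IS TWO-LEVEL WITH LEVELS `j₀, j₀ + 1`** (`R ≥ 2L²`: p38's `two_level_ball` on the `3L·S_j/2`-ball, read against the least level).
[cite: Balaban1984PropagatorsII, (2.2) p.224, p.230, p.238] -/
theorem two_level (hL : Odd (ℓ + 1) ∧ 1 < ℓ + 1) (hR2 : 2 * (ℓ + 1) ^ 2 ≤ R) {w : ↥(boxDom (N0 ℓ Mh k P'))}
    (hw : dist (toR w.1) (ctr (Dch D c) (cc D hMh1 hP4 c)) ≤ rho ℓ Mh c.1.1) :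
    j0 hMh1 hP4 c ≤ (Dch D c).lev w.1 ∧ (Dch D c).lev w.1 ≤ j0 hMh1 hP4 c + 1 := by
  have hℓ : 1 ≤ ℓ := by have := hL.2; omega
  have hS := one_le_bigSide_real (ℓ := ℓ) hMh1 c.1.1
  have hRr : (2 : ℝ) * ((ℓ : ℝ) + 1) ^ 2 ≤ R := by exact_mod_cast hR2
  have hρ : (rho ℓ Mh c.1.1 + (bigSide ℓ Mh c.1.1 : ℝ) / 2) * ((ℓ : ℝ) + 1) ≤ (R : ℝ) * (bigSide ℓ Mh c.1.1 : ℝ) := by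
    have hl : (0 : ℝ) ≤ ℓ := Nat.cast_nonneg _
    have h1 : (2 * ((ℓ : ℝ) + 1) ^ 2) * (bigSide ℓ Mh c.1.1 : ℝ) ≤ (R : ℝ) * (bigSide ℓ Mh c.1.1 : ℝ) :=
      mul_le_mul_of_nonneg_right hRr (by linarith)
    have h2 : (0 : ℝ) ≤ (ℓ : ℝ) * ((ℓ : ℝ) + 1) * (bigSide ℓ Mh c.1.1 : ℝ) := by positivity
    unfold rho; nlinarith
  obtain ⟨j', _, hj'⟩ := two_level_ball (D := D) hℓ hMh1 hP4 c hρ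
  obtain ⟨w₁, hw₁, hl₁⟩ := jmin_mem hMh1 hP4 c
  have h1 := (hj' w₁ hw₁).1
  have h2 := (hj' w hw).2
  have h3 := jmin_le hMh1 hP4 c hw
  have h4 := (Dch D c).lev_le w.1
  rw [hl₁] at h1
  unfold j0
  constructor
  · exact le_trans (min_le_left _ _) h3
  · rcases le_or_gt (jmin hMh1 hP4 c) (k - 1) with h | h
    · rw [min_eq_left h]; omega
    · rw [min_eq_right (le_of_lt h)]; omega

/-- `j₀ ≤ j ≤ j₀ + 1` (the cube's own level is one of the two). [cite: Balaban1984PropagatorsII, p.238, bookkeeping] -/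
theorem j0_le_level (hL : Odd (ℓ + 1) ∧ 1 < ℓ + 1) (hR2 : 2 * (ℓ + 1) ^ 2 ≤ R) : j0 hMh1 hP4 c ≤ c.1.1 ∧ c.1.1 ≤ j0 hMh1 hP4 c + 1 := by
  have h := two_level hMh1 hP4 c hL hR2 (wit_mem_ball hMh1 hP4 c)
  rwa [lev_wit] at h

/-- the dichotomy of the clamp: either `j₀ = jmin` (attained in the ball) or the ball sees only the top level and `j₀ + 1 = k`.
[cite: Balaban1984PropagatorsII, p.238, bookkeeping] -/
theorem j0_dichotomy (hk1 : 1 ≤ k) : (∃ w : ↥(boxDom (N0 ℓ Mh k P')), dist (toR w.1) (ctr (Dch D c) (cc D hMh1 hP4 c)) ≤ rho ℓ Mh c.1.1 ∧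
      (Dch D c).lev w.1 = j0 hMh1 hP4 c) ∨ j0 hMh1 hP4 c + 2 = k + 1 := by
  have hb := jmin_bounds hMh1 hP4 c
  rcases le_or_gt (jmin hMh1 hP4 c) (k - 1) with h | h
  · left
    obtain ⟨w, hw, hl⟩ := jmin_mem hMh1 hP4 c
    exact ⟨w, hw, by unfold j0; rw [min_eq_left h]; exact hl⟩
  · right; unfold j0; rw [min_eq_right (le_of_lt h)]; omega

end Levels

/-! ## §4  The member's geometric inputs: two-level window (`hlev`), separation (`hfar`), the support of `h_□` and the reach `□⁺` in the window -/

section Inputs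

open B5Eq118OneStroke (iterBlockOf iterBlock mem_iterBlock)
open B4TorusKernel.MultiPeriod (torusSupNorm)
open B6Geom246MultiLevelTorus (torusSupNorm_neg)
open B6GlobalChartV1 (toBox_surjective)
open B6GlobalChartV1L0 (iterBlockOf_mem_domT_iff)
open B6MemberOfCubeV1 (one_le_N0 torusSupNorm_lt_of_block_shift torusSupNorm_sub_le)
open B6Prop26ReachTransplant (InWindow)
open B4TorusKernel.MultiPeriod (torusSupNorm_le_supNorm)

variable (hN : ∀ μ, N0 ℓ Mh k P' μ = (PV d ℓ m K hd hL).sitesPerDir 0) {D : TDomains d ℓ Mh k P' R} (hk : k ≤ m + K)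
  (hMh1 : 1 ≤ Mh) (hP4 : ∀ μ, 4 ≤ P' μ) {a : ℕ} (hMha : Mh = (ℓ + 1) ^ a) (c : ↥(cubes D.toDomains)) (ha : a₀ ≤ a₁)

/-! ### `hlev` -/

include hMha in
/-- **`hlev` OF THE MEMBER OF THE CUBE**: every window site has chart level `j₀` or `j₀ + 1` (`R ≥ 2L²`). [cite: Balaban1984PropagatorsII, (2.2) p.224, p.238] -/
theorem hlev_deep (hR2 : 2 * (ℓ + 1) ^ 2 ≤ R) :
    ∀ x : Site (PV d ℓ m K hd hL) 0, x ∈ DeepS (bare d ℓ hd hL (eC a c.1.1) 0 (j0 hMh1 hP4 c) (j0_hj hMh1 hP4 c a) ha) (x0 ℓ Mh k c.1) 0 →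
      j0 hMh1 hP4 c ≤ (D.chart (svec ℓ k c.1.1 c.1.2)).lev (toBox hN x) ∧
        (D.chart (svec ℓ k c.1.1 c.1.2)).lev (toBox hN x) ≤ j0 hMh1 hP4 c + 1 :=
  fun x hx => two_level hMh1 hP4 c hL hR2 (w := toBox hN x) (dist_le_of_deep hN hMh1 hP4 hMha c _ ha hx)

include hMha in
/-- **`hlev` ON THE LOWER HALF-WINDOW** (the input of `reach2133_G_V1_full`). [cite: Balaban1984PropagatorsII, (2.2) p.224, p.238] -/
theorem hlev_window (hL : Odd (ℓ + 1) ∧ 1 < ℓ + 1) (hR2 : 2 * (ℓ + 1) ^ 2 ≤ R) :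
    ∀ z ∈ boxDom (N0 ℓ Mh k P'), (∀ μ, x0 ℓ Mh k c.1 μ ≤ z μ ∧ z μ < x0 ℓ Mh k c.1 μ + ((ℓ + 1) ^ eC a c.1.1 : ℕ)) →
      j0 hMh1 hP4 c ≤ (D.chart (svec ℓ k c.1.1 c.1.2)).lev z ∧ (D.chart (svec ℓ k c.1.1 c.1.2)).lev z ≤ j0 hMh1 hP4 c + 1 := by
  intro z hz hw
  have h := dist_le_of_inWindow hMh1 hP4 hMha c hL hw
  have hS := one_le_bigSide_real (ℓ := ℓ) hMh1 c.1.1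
  have hl : (0 : ℝ) ≤ ℓ := Nat.cast_nonneg _
  exact two_level hMh1 hP4 c hL hR2 (w := ⟨z, hz⟩) (h.trans (by unfold rho; nlinarith))

/-! ### `hfar` -/

/-- `(y − e_μ) + e_μ = y`. [folklore] -/
private theorem munshift_shift {P : Params} {j : ℕ} (y : Site P j) (μ : Fin P.d) : (y.unshift μ).shift μ = y := by
  funext ν
  by_cases h : ν = μ
  · subst h; simp [Site.shift, Site.unshift]
  · simp [Site.shift, Site.unshift, Function.update_of_ne h]

/-- **`hfar` FROM (2.2) ON THE TORUS, AGAINST A SITE OF LEVEL `≤ j`** (the variant of `B6MemberOfCubeV1L0.hfar_of_sepT` with `lev x₁ ≤ j`): no `n`-block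
adjacent to the `n`-block of a deep window site lies in `Ω_n`, `j + 2 ≤ n ≤ k`. [cite: Balaban1984PropagatorsII, (2.2) p.224, p.238 («□ connected with a L^{−j}-scale»)] -/
theorem hfar_of_sepT_le (D : B6MultiLevelTorusOperatorL0.TDomains d ℓ Mh k P' R) {t : TSIdx d (ℓ + 1) hd hL a₀ a₁} {x₀ : Fin (d + 1) → ℤ}
    {r : ℕ} {Δ : ℝ} (x₁ : Site (PV d ℓ m K hd hL) 0) (hx₁ : D.lev (toBox hN x₁).1 ≤ t.j)
    (hΔ : ∀ x, x ∈ DeepS t x₀ r → torusSupNorm (N0 ℓ Mh k P') ((toBox hN x₁).1 - (toBox hN x).1) ≤ Δ)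
    (hR : ∀ n, t.j + 2 ≤ n → n ≤ k → Δ + 2 * (((ℓ + 1 : ℕ) : ℝ)) ^ n ≤ ((R * bigSide ℓ Mh (n - 1) : ℕ) : ℝ)) :
    ∀ n, t.j + 2 ≤ n → n ≤ k → ∀ x : Site (PV d ℓ m K hd hL) 0, x ∈ DeepS t x₀ r → ∀ μ,
      (iterBlockOf n x).shift μ ∉ (domT hN D hk).Om n ∧ (iterBlockOf n x).unshift μ ∉ (domT hN D hk).Om n := by
  intro n hn hnk x hx μ
  have hnm : n ≤ m + K := le_trans hnk hk
  have hN1 := one_le_N0 hN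
  have main : ∀ x' : Site (PV d ℓ m K hd hL) 0, n ≤ D.lev (toBox hN x').1 →
      ¬ torusSupNorm (N0 ℓ Mh k P') ((toBox hN x).1 - (toBox hN x').1) < 2 * (((ℓ + 1 : ℕ) : ℝ)) ^ n := by
    intro x' hlev hclose
    have hsep := D.sepT (n - 1) (toBox hN x₁).1 (toBox hN x₁).2 (toBox hN x').1 (toBox hN x').2 (by omega) (by omega)
    have htri := torusSupNorm_sub_le hN1 (toBox hN x₁).1 (toBox hN x).1 (toBox hN x').1
    have := hR n hn hnk
    linarith [hΔ x hx]
  have get : ∀ Y : Site (PV d ℓ m K hd hL) n, Y ∈ (domT hN D hk).Om n →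
      ∃ x' : Site (PV d ℓ m K hd hL) 0, iterBlockOf n x' = Y ∧ n ≤ D.lev (toBox hN x').1 := by
    intro Y hY
    obtain ⟨x', hx'⟩ := B6AgreeQaQV1Chart.iterBlock_nonempty (P := PV d ℓ m K hd hL) hnm Y
    rw [mem_iterBlock] at hx'
    exact ⟨x', hx', (iterBlockOf_mem_domT_iff hN D hk hnk x').1 (by rw [hx']; exact hY)⟩
  constructor
  · intro hY
    obtain ⟨x', hx', hlev⟩ := get _ hY
    exact main x' hlev (torusSupNorm_lt_of_block_shift hN hnm hx')
  · intro hY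
    obtain ⟨x', hx', hlev⟩ := get _ hY
    have h' : iterBlockOf n x = (iterBlockOf n x').shift μ := by rw [hx', munshift_shift]
    have hclose := torusSupNorm_lt_of_block_shift hN hnm h'
    rw [show (toBox hN x').1 - (toBox hN x).1 = -((toBox hN x).1 - (toBox hN x').1) by abel, torusSupNorm_neg hN1] at hclose
    exact main x' hlev hclose

include hMha in
/-- **`hfar` OF THE MEMBER OF THE CUBE** (`R ≥ 2L²`): for `j₀ + 2 ≤ n ≤ k` no `n`-block adjacent to the `n`-block of an `r`-deep window site lies in
`Ω_n` of the chart family — (2.2) against a site of level `j₀` in the `3L·S_j/2`-ball (or vacuous when the ball sees only the top level).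
[cite: Balaban1984PropagatorsII, (2.2) p.224, p.238] -/
theorem hfar_cube (hR2 : 2 * (ℓ + 1) ^ 2 ≤ R) (r : ℕ) :
    ∀ n, j0 hMh1 hP4 c + 2 ≤ n → n ≤ k → ∀ x : Site (PV d ℓ m K hd hL) 0,
      x ∈ DeepS (bare d ℓ hd hL (eC a c.1.1) 0 (j0 hMh1 hP4 c) (j0_hj hMh1 hP4 c a) ha) (x0 ℓ Mh k c.1) r → ∀ μ,
      (iterBlockOf n x).shift μ ∉ (domT hN (D.chart (svec ℓ k c.1.1 c.1.2)) hk).Om n ∧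
        (iterBlockOf n x).unshift μ ∉ (domT hN (D.chart (svec ℓ k c.1.1 c.1.2)) hk).Om n := by
  -- LEVEL-0 TWIN (JOINT J7): `1 ≤ k` is read off the range `j₀ + 2 ≤ n ≤ k` (vacuous statement otherwise)
  by_cases hk1 : 1 ≤ k
  swap
  · intro n hn hnk; exact absurd (le_trans hn hnk) (by omega)
  rcases j0_dichotomy hMh1 hP4 c hk1 with ⟨w, hw, hlw⟩ | htop
  · obtain ⟨x₁, hx₁⟩ := toBox_surjective hN w
    have hS := one_le_bigSide_real (ℓ := ℓ) hMh1 c.1.1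
    have hN1 := one_le_N0 hN
    refine hfar_of_sepT_le hN hk (D.chart (svec ℓ k c.1.1 c.1.2)) (t := bare d ℓ hd hL (eC a c.1.1) 0 (j0 hMh1 hP4 c) (j0_hj hMh1 hP4 c a) ha)
      (Δ := 2 * rho ℓ Mh c.1.1) x₁ (by rw [hx₁]; exact le_of_eq hlw) (fun x hx => ?_) (fun n hn hnk => ?_)
    · -- both sites lie in the ball
      have h1 : dist (toR (toBox hN x).1) (ctr (Dch D c) (cc D hMh1 hP4 c)) ≤ rho ℓ Mh c.1.1 :=
        dist_le_of_deep hN hMh1 hP4 hMha c _ ha (deepS_mono (Nat.zero_le r) hx)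
      rw [hx₁] at *
      calc torusSupNorm (N0 ℓ Mh k P') (w.1 - (toBox hN x).1) ≤ supNorm (w.1 - (toBox hN x).1) := torusSupNorm_le_supNorm hN1 _
        _ = dist (toR w.1) (toR (toBox hN x).1) := supNorm_eq_dist _ _
        _ ≤ dist (toR w.1) (ctr (Dch D c) (cc D hMh1 hP4 c)) + dist (toR (toBox hN x).1) (ctr (Dch D c) (cc D hMh1 hP4 c)) :=
            dist_triangle_right _ _ _
        _ ≤ 2 * rho ℓ Mh c.1.1 := by linarith
    · -- `2ρ + 2L^n ≤ R·M_h·L^n` for `n ≥ j₀ + 2 ≥ j + 1`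
      change j0 hMh1 hP4 c + 2 ≤ n at hn
      have hj := (j0_le_level hMh1 hP4 c hL hR2).2
      obtain ⟨s', hs'⟩ : ∃ s', n = c.1.1 + 1 + s' := ⟨n - (c.1.1 + 1), by omega⟩
      have e1 : ((R * bigSide ℓ Mh (n - 1) : ℕ) : ℝ) = (R : ℝ) * (Mh : ℝ) * ((ℓ : ℝ) + 1) ^ n := by
        have : n - 1 + 1 = n := by omega
        unfold bigSide; rw [this]; push_cast; ring
      have e2 : 2 * rho ℓ Mh c.1.1 = 3 * (Mh : ℝ) * ((ℓ : ℝ) + 1) ^ (c.1.1 + 2) := by unfold rho bigSide; push_cast; ring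
      have hRr : (2 : ℝ) * ((ℓ : ℝ) + 1) ^ 2 ≤ R := by exact_mod_cast hR2
      have hM : (1 : ℝ) ≤ Mh := by exact_mod_cast hMh1
      have hl : (1 : ℝ) ≤ (ℓ : ℝ) + 1 := by have : (0 : ℝ) ≤ ℓ := Nat.cast_nonneg _; linarith
      have hpow : ((ℓ : ℝ) + 1) ^ (c.1.1 + 2) ≤ ((ℓ : ℝ) + 1) * ((ℓ : ℝ) + 1) ^ n := by
        rw [← pow_succ', hs']; exact pow_le_pow_right₀ hl (by omega)
      have hLn : (0 : ℝ) < ((ℓ : ℝ) + 1) ^ n := by positivity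
      have hl2 : (2 : ℝ) ≤ (ℓ : ℝ) + 1 := by
        have h1 : (1 : ℝ) ≤ ℓ := by exact_mod_cast (show 1 ≤ ℓ by have := hL.2; omega)
        linarith
      have s1 : 3 * (Mh : ℝ) * ((ℓ : ℝ) + 1) ^ (c.1.1 + 2) ≤ 3 * (Mh : ℝ) * (((ℓ : ℝ) + 1) * ((ℓ : ℝ) + 1) ^ n) :=
        mul_le_mul_of_nonneg_left hpow (by positivity)
      have s2 : 2 * ((ℓ : ℝ) + 1) ^ n ≤ 2 * ((Mh : ℝ) * ((ℓ : ℝ) + 1) ^ n) := by nlinarith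
      have s3 : 3 * ((ℓ : ℝ) + 1) + 2 ≤ (R : ℝ) := by nlinarith
      have s4 : (Mh : ℝ) * ((ℓ : ℝ) + 1) ^ n * (3 * ((ℓ : ℝ) + 1) + 2) ≤ (Mh : ℝ) * ((ℓ : ℝ) + 1) ^ n * R :=
        mul_le_mul_of_nonneg_left s3 (by positivity)
      rw [e1, e2]; push_cast
      calc 3 * (Mh : ℝ) * ((ℓ : ℝ) + 1) ^ (c.1.1 + 2) + 2 * ((ℓ : ℝ) + 1) ^ n
          ≤ 3 * (Mh : ℝ) * (((ℓ : ℝ) + 1) * ((ℓ : ℝ) + 1) ^ n) + 2 * ((Mh : ℝ) * ((ℓ : ℝ) + 1) ^ n) := add_le_add s1 s2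
        _ = (Mh : ℝ) * ((ℓ : ℝ) + 1) ^ n * (3 * ((ℓ : ℝ) + 1) + 2) := by ring
        _ ≤ (Mh : ℝ) * ((ℓ : ℝ) + 1) ^ n * R := s4
        _ = (R : ℝ) * (Mh : ℝ) * ((ℓ : ℝ) + 1) ^ n := by ring
  · intro n hn hnk; exfalso; omega

/-! ### The support of `h_□` read in the chart -/

/-- **`h_□` IN THE CHART FRAME**: `h^ch_□(b) := h^F_{cc}(b₋)` — p38's box function of the central cube read at the chart point of the initial
site of the bond (the translate of the skeleton's `hB` by the chart vector, §6). [cite: Balaban1984PropagatorsII, (2.36) p.229, (2.91) p.239] -/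
def hch (hMh1 : 1 ≤ Mh) (hP4 : ∀ μ, 4 ≤ P' μ) (c : ↥(cubes D.toDomains)) (b : PBond (PV d ℓ m K hd hL) 0) : ℝ :=
  hF (Dch D c) (cc D hMh1 hP4 c) (toBox hN b.src)

/-- unfolding `hch`. [cite: Balaban1984PropagatorsII, (2.36) p.229, dictionary] -/
@[simp] theorem hch_apply (b : PBond (PV d ℓ m K hd hL) 0) : hch hN hMh1 hP4 c b = hF (Dch D c) (cc D hMh1 hP4 c) (toBox hN b.src) := rfl

include hMha in
/-- **`supp h_□` IS `4L^{j₀+1}`-DEEP IN THE WINDOW** (`M_h ≥ 8`: `supp h_□ ⊂ {|x − ctr| < S_j}` and `S_j + 4L^{j₀+1} ≤ 3S_j/2 ≤ L·S_j/2`).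
[cite: Balaban1984PropagatorsII, p.229 («cubes □ of the size 2ML^jη»), p.238 (□ ⊂ □̃³)] -/
theorem hch_deep (hM8 : 8 ≤ Mh) (hR2 : 2 * (ℓ + 1) ^ 2 ≤ R) {b : PBond (PV d ℓ m K hd hL) 0} (hb : hch hN hMh1 hP4 c b ≠ 0) :
    b ∈ DeepB (bare d ℓ hd hL (eC a c.1.1) 0 (j0 hMh1 hP4 c) (j0_hj hMh1 hP4 c a) ha) (x0 ℓ Mh k c.1) (4 * (ℓ + 1) ^ (j0 hMh1 hP4 c + 1)) := by
  have hd1 := dist_lt_of_hF_ne_zero (Dch D c) hMh1 hb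
  rw [side_cc] at hd1
  refine deep_of_dist_le hN hMh1 hP4 hMha c _ ha ?_
  -- `4L^{j₀+1} ≤ S_j/2` and `S_j + S_j/2 ≤ L·S_j/2`
  have hj := (j0_le_level hMh1 hP4 c hL hR2).1
  have hM : (8 : ℝ) ≤ Mh := by exact_mod_cast hM8
  have hl : (2 : ℝ) ≤ ℓ := by have := hL.2; obtain ⟨r, hr⟩ := hL.1; exact_mod_cast (by omega : 2 ≤ ℓ)
  have hl1 : (1 : ℝ) ≤ (ℓ : ℝ) + 1 := by linarith
  have hpow : ((ℓ : ℝ) + 1) ^ (j0 hMh1 hP4 c + 1) ≤ ((ℓ : ℝ) + 1) ^ (c.1.1 + 1) := pow_le_pow_right₀ hl1 (by omega)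
  have eS : (bigSide ℓ Mh c.1.1 : ℝ) = (Mh : ℝ) * ((ℓ : ℝ) + 1) ^ (c.1.1 + 1) := by unfold bigSide; push_cast; ring
  have hp0 : (0 : ℝ) ≤ ((ℓ : ℝ) + 1) ^ (j0 hMh1 hP4 c + 1) := by positivity
  push_cast
  rw [eS] at hd1 ⊢
  nlinarith [mul_le_mul_of_nonneg_left hpow (by norm_num : (0 : ℝ) ≤ 8), mul_le_mul_of_nonneg_right hM (le_trans hp0 hpow)]

include hMha in
/-- `supp h_□` lies in the window. [cite: Balaban1984PropagatorsII, p.238 (□ ⊂ □̃³), bookkeeping] -/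
theorem hch_deep0 (hM8 : 8 ≤ Mh) (hR2 : 2 * (ℓ + 1) ^ 2 ≤ R) {b : PBond (PV d ℓ m K hd hL) 0} (hb : hch hN hMh1 hP4 c b ≠ 0) :
    b.src ∈ DeepS (bare d ℓ hd hL (eC a c.1.1) 0 (j0 hMh1 hP4 c) (j0_hj hMh1 hP4 c a) ha) (x0 ℓ Mh k c.1) 0 :=
  deepS_mono (Nat.zero_le _) (hch_deep hN hMh1 hP4 hMha c ha hM8 hR2 hb)

/-! ### The reach `□⁺` of the central cube lies in the lower half-window; its blocks have level `≥ j₀` -/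

/-- a site of a block of `□⁺` is within `3S_j/2 − 1/2` of the centre (`M_h ≥ 2`, `R ≥ 2L`: blocks of `□⁺` have level `≤ j + 1`, side `≤ S_j/2`).
[cite: Balaban1984PropagatorsII, p.235 («a second cube □̃ containing □ in the middle»), bookkeeping] -/
theorem dist_lt_of_blkOf_mem_Q (hMh : 2 ≤ Mh) (hR : 2 * (ℓ + 1) ≤ R) {z : ↥(boxDom (N0 ℓ Mh k P'))}
    (hz : B6Geom246MultiLevelBoxL0.blkOf (Dch D c) z ∈ Q (Dch D c) (cc D hMh1 hP4 c)) :
    dist (toR z.1) (ctr (Dch D c) (cc D hMh1 hP4 c)) ≤ 3 * (bigSide ℓ Mh c.1.1 : ℝ) / 2 - 1 / 2 := by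
  have h1 := (mem_Q (Dch D c)).1 hz
  rw [side_cc] at h1
  have h2 := dist_toR_cen_le (Dch D c) (rfl : blkOf (Dch D c) z = blkOf (Dch D c) z)
  have hlev : (blkOf (Dch D c) z).1.1 ≤ c.1.1 + 1 := (window (Dch D c) hMh1 hR hz).2
  have h3 := pow_le_half_bigSide (ℓ := ℓ) hMh hlev
  linarith [dist_triangle (toR z.1) (cen (Dch D c) (blkOf (Dch D c) z)) (ctr (Dch D c) (cc D hMh1 hP4 c))]

include hMha in
/-- **THE BONDS WHOSE CHART BLOCK LIES IN `□⁺` ARE IN THE LOWER HALF-WINDOW** (the input `hS` of `reach2133_G_V1_full`; `L ≥ 3`).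
[cite: Balaban1984PropagatorsII, p.238 («□ ⊂ □̃ ⊂ □̃² ⊂ □̃³»), (2.133) p.247] -/
theorem inWindow_of_blk_mem_Q (hMh : 2 ≤ Mh) (hR : 2 * (ℓ + 1) ≤ R) (b : PBond (PV d ℓ m K hd hL) 0)
    (hb : B6GlobalChartV1L0.blkV1 hN (D.chart (svec ℓ k c.1.1 c.1.2)) b ∈ Q (Dch D c) (cc D hMh1 hP4 c)) :
    InWindow (fun b : PBond (PV d ℓ m K hd hL) 0 => (toBox hN b.src : Fin (d + 1) → ℤ)) (x0 ℓ Mh k c.1) ((ℓ + 1) ^ eC a c.1.1) b := by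
  intro μ
  have h := dist_lt_of_blkOf_mem_Q hMh1 hP4 c hMh hR (z := toBox hN b.src) hb
  have hS := one_le_bigSide_real (ℓ := ℓ) hMh1 c.1.1
  have hl : (2 : ℝ) ≤ ℓ := by have := hL.2; obtain ⟨r, hr⟩ := hL.1; exact_mod_cast (by omega : 2 ≤ ℓ)
  exact inWindow_of_dist_lt hMh1 hP4 hMha c hL (lt_of_le_of_lt h (by nlinarith)) μ

/-- **THE BLOCKS OF `□⁺` HAVE LEVEL `≥ j₀`** (they lie in the two-level ball). [cite: Balaban1984PropagatorsII, (2.2) p.224, p.235, p.238] -/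
theorem j0_le_of_mem_Q (hMh : 2 ≤ Mh) (hR2 : 2 * (ℓ + 1) ^ 2 ≤ R) (hL : Odd (ℓ + 1) ∧ 1 < ℓ + 1) {y : ↥(bset (Dch D c))}
    (hy : y ∈ Q (Dch D c) (cc D hMh1 hP4 c)) : j0 hMh1 hP4 c ≤ y.1.1 := by
  obtain ⟨z, rfl⟩ := exists_blkOf_eq (Dch D c) y
  have hR : 2 * (ℓ + 1) ≤ R := le_trans (by nlinarith : 2 * (ℓ + 1) ≤ 2 * (ℓ + 1) ^ 2) hR2
  have h := dist_lt_of_blkOf_mem_Q hMh1 hP4 c hMh hR hy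
  have hS := one_le_bigSide_real (ℓ := ℓ) hMh1 c.1.1
  have hl : (0 : ℝ) ≤ ℓ := Nat.cast_nonneg _
  have h2 := (two_level hMh1 hP4 c hL hR2 (w := z) (h.trans (by unfold rho; nlinarith))).1
  rwa [lev_eq_of_blkOf_eq (Dch D c) rfl] at h2

end Inputs

/-! ## §5  The member of the cube and its operators `G_□`, `M_□`, `P_□` IN THE CHART FRAME; (hagree), (hinvl), (2.133) there -/

section Members

open B6SectAOperatorsV1 (dE dsE dcE dcsE QE aE QsE BondIdx)
open B6Prop26Gluing (mulOp LocalMajorant)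
open B6Prop26ReachTransplant (transplant chartBond InWindow)
open B6Ineq2133TwoScaleV1 (onFun)
open B6RandomWalk (BlockSupp)
open B6AgreeLapV1Chart (cB posV mem_cB_W)
open B6AgreeQaQV1Chart (NearB)
open B6MemberOfCubeV1L0 (tOf tOf_j hagree_tOf)
open B6FullWindowReachV1 (hinvl_GlV1_scaled)
open B6GlobalChartV1 (GlV1)
open B6Prop26KLevelSkeletonV1L0 (pref)
open B6Geom246MultiLevelTorusL0 (geomT)

/-- `x₀ ≥ 0` for a placed cube. [cite: Balaban1984PropagatorsII, p.238, bookkeeping] -/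
theorem hx0 {D : B6MultiLevelTorusOperatorL0.TDomains d ℓ Mh k P' R} {c : ↥(cubes D.toDomains)} (hpl : Placed ℓ k P' c.1) : ∀ μ, 0 ≤ x0 ℓ Mh k c.1 μ :=
  x0_nonneg c.1 fun μ => (hpl μ).1

/-- the member period fits, for a placed cube. [cite: Balaban1984PropagatorsII, p.238, bookkeeping] -/
theorem hfit (hN : ∀ μ, N0 ℓ Mh k P' μ = (PV d ℓ m K hd hL).sitesPerDir 0) {D : TDomains d ℓ Mh k P' R} (hMh1 : 1 ≤ Mh) (hP4 : ∀ μ, 4 ≤ P' μ)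
    {a : ℕ} (hMha : Mh = (ℓ + 1) ^ a) (c : ↥(cubes D.toDomains)) (ha : a₀ ≤ a₁) (hpl : Placed ℓ k P' c.1) :
    ∀ μ, x0 ℓ Mh k c.1 μ + ((bare d ℓ hd hL (eC a c.1.1) 0 (j0 hMh1 hP4 c) (j0_hj hMh1 hP4 c a) ha).P.sitesPerDir 0 : ℕ) ≤
      ((PV d ℓ m K hd hL).sitesPerDir 0 : ℕ) :=
  x0_fit hN hMha c.1 (level_bounds D.toDomains c).2 (fun μ => (hpl μ).2) (j0_hj hMh1 hP4 c a) ha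

section Defs

variable (hN : ∀ μ, N0 ℓ Mh k P' μ = (PV d ℓ m K hd hL).sitesPerDir 0) {D : TDomains d ℓ Mh k P' R} (hk : k ≤ m + K)
  (hMh1 : 1 ≤ Mh) (hP4 : ∀ μ, 4 ≤ P' μ) {a : ℕ} (hMha : Mh = (ℓ + 1) ^ a) (c : ↥(cubes D.toDomains)) (ha : a₀ ≤ a₁)

/-- **THE MEMBER `t(□)` OF THE CUBE** (in the chart frame `D.chart s_□`, chart-frame weights `wc`, fine factor `c′`): `B6MemberOfCubeV1L0.tOf` of size
`(a + j + 2, 0)`, scale `j₀(□)`, corner `x₀(□)` — `Λ′(□) = e(Ω_{j₀+1} ∩ window)`, `w_□ = clamp(wc ∘ e⁻¹/(c′/L^{j₀})²)`.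
[cite: Balaban1984PropagatorsII, (2.89)–(2.90) p.239, p.238] -/
def tC (a : ℕ) (wc : BondIdx (domT hN (D.chart (svec ℓ k c.1.1 c.1.2)) hk) → ℝ) (cf : ℝ) : TSIdx d (ℓ + 1) hd hL a₀ a₁ :=
  tOf hN (D.chart (svec ℓ k c.1.1 c.1.2)) hk wc cf (eC a c.1.1) 0 (j0 hMh1 hP4 c) (j0_hj hMh1 hP4 c a) ha (x0 ℓ Mh k c.1)

/-- the scale of `t(□)` is `j₀(□)`. [cite: Balaban1984PropagatorsII, p.238, dictionary] -/
@[simp] theorem tC_j (a : ℕ) (wc : BondIdx (domT hN (D.chart (svec ℓ k c.1.1 c.1.2)) hk) → ℝ) (cf : ℝ) :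
    (tC hN hk hMh1 hP4 c ha a wc cf).j = j0 hMh1 hP4 c := rfl

/-- **THE UNIT `s(□) := (c′/L^{j₀})²`** of the rescaling (2.94). [cite: Balaban1984PropagatorsII, (2.94) p.239] -/
def sc (cf : ℝ) : ℝ := (cf / (((ℓ + 1 : ℕ) : ℝ)) ^ j0 hMh1 hP4 c) ^ 2

/-- `s(□) ≠ 0` for `c′ ≠ 0`. [cite: Balaban1984PropagatorsII, (2.94) p.239, bookkeeping] -/
theorem sc_ne_zero {cf : ℝ} (hcf : cf ≠ 0) : sc hMh1 hP4 c cf ≠ 0 := by unfold sc; positivity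

/-- `s(□)⁻¹ = (L^{j₀}/c′)²`. [cite: Balaban1984PropagatorsII, (2.94) p.239, bookkeeping] -/
theorem sc_inv (cf : ℝ) : (sc hMh1 hP4 c cf)⁻¹ = ((((ℓ + 1 : ℕ) : ℝ)) ^ j0 hMh1 hP4 c / cf) ^ 2 := by
  unfold sc; rw [← inv_pow, inv_div]

/-- **`G_□` IN THE CHART FRAME**: `s(□)⁻¹ •` the full-window transplant of the member's `G`. [cite: Balaban1984PropagatorsII, (2.90)–(2.91), (2.94) p.239] -/
def GlC (hpl : Placed ℓ k P' c.1) (wc : BondIdx (domT hN (D.chart (svec ℓ k c.1.1 c.1.2)) hk) → ℝ) (cf : ℝ) :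
    Module.End ℝ (PBond (PV d ℓ m K hd hL) 0 → ℝ) :=
  (sc hMh1 hP4 c cf)⁻¹ • GlV1 (tC hN hk hMh1 hP4 c ha a wc cf) hN
    (cB (tC hN hk hMh1 hP4 c ha a wc cf) (x0 ℓ Mh k c.1) (hx0 hpl) (hfit hN hMh1 hP4 hMha c ha hpl)).W (x0 ℓ Mh k c.1)

/-- **`M_□` IN THE CHART FRAME**: `s(□) •` the transplant of the member's local operator `Δ_□ + Q*a_□Q`. [cite: Balaban1984PropagatorsII, (2.91), (2.94) p.239] -/
def MlC (hpl : Placed ℓ k P' c.1) (wc : BondIdx (domT hN (D.chart (svec ℓ k c.1.1 c.1.2)) hk) → ℝ) (cf : ℝ) :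
    Module.End ℝ (PBond (PV d ℓ m K hd hL) 0 → ℝ) :=
  sc hMh1 hP4 c cf • transplant (cB (tC hN hk hMh1 hP4 c ha a wc cf) (x0 ℓ Mh k c.1) (hx0 hpl) (hfit hN hMh1 hP4 hMha c ha hpl)).W
    (chartBond (tC hN hk hMh1 hP4 c ha a wc cf) posV PBond.dir (x0 ℓ Mh k c.1))
    (onFun ((tC hN hk hMh1 hP4 c ha a wc cf).D.lapV +
      LinearMap.adjoint (tC hN hk hMh1 hP4 c ha a wc cf).D.Q ∘ₗ (tC hN hk hMh1 hP4 c ha a wc cf).D.a ∘ₗ (tC hN hk hMh1 hP4 c ha a wc cf).D.Q))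

/-- **`P_□ = ε(∂P_□∂*)ρ` IN THE CHART FRAME** (scaled). [cite: Balaban1984PropagatorsII, (2.91), (2.94) p.239] -/
def PlC (hpl : Placed ℓ k P' c.1) (wc : BondIdx (domT hN (D.chart (svec ℓ k c.1.1 c.1.2)) hk) → ℝ) (cf : ℝ) :
    Module.End ℝ (PBond (PV d ℓ m K hd hL) 0 → ℝ) :=
  sc hMh1 hP4 c cf • transplant (cB (tC hN hk hMh1 hP4 c ha a wc cf) (x0 ℓ Mh k c.1) (hx0 hpl) (hfit hN hMh1 hP4 hMha c ha hpl)).W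
    (chartBond (tC hN hk hMh1 hP4 c ha a wc cf) posV PBond.dir (x0 ℓ Mh k c.1))
    (onFun ((tC hN hk hMh1 hP4 c ha a wc cf).D.grad ∘ₗ (tC hN hk hMh1 hP4 c ha a wc cf).D.P ∘ₗ (tC hN hk hMh1 hP4 c ha a wc cf).D.dv))

/-- **(hagree) IN THE CHART FRAME**: `M·h_□ = M_□·h_□` for the local part `M = ∂*∂ + ∂∂* + Q*aQ` of the chart-frame `Δ_a` (weights `wc`), `h_□ = hch`
— `B6MemberOfCubeV1L0.hagree_tOf` with this file's `hlev`, `hfar`, support (`k ≥ 2`, `M_h ≥ 8`, `R ≥ 2L²`, placed cube); the weight band `hband` of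
the chart-frame weights near the window stays displayed. [cite: Balaban1984PropagatorsII, (2.89)–(2.91) p.239, (2.2) p.224] -/
theorem hagreeC (hk2 : 2 ≤ k) (hM8 : 8 ≤ Mh) (hR2 : 2 * (ℓ + 1) ^ 2 ≤ R) (hpl : Placed ℓ k P' c.1)
    (wc : BondIdx (domT hN (D.chart (svec ℓ k c.1.1 c.1.2)) hk) → ℝ) {cf : ℝ} (hcf : cf ≠ 0)
    (hband : ∀ i : BondIdx (domT hN (D.chart (svec ℓ k c.1.1 c.1.2)) hk), ((i.1.1 : ℕ) = j0 hMh1 hP4 c ∨ (i.1.1 : ℕ) = j0 hMh1 hP4 c + 1) →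
      NearB (bare d ℓ hd hL (eC a c.1.1) 0 (j0 hMh1 hP4 c) (j0_hj hMh1 hP4 c a) ha) (x0 ℓ Mh k c.1) (4 * (ℓ + 1) ^ (j0 hMh1 hP4 c + 1)) i.1.1 i.1.2 →
      a₀ * ((((ℓ + 1 : ℕ) : ℝ)) ^ j0 hMh1 hP4 c) ^ (d + 1) ≤ wc i / (cf / (((ℓ + 1 : ℕ) : ℝ) ^ j0 hMh1 hP4 c)) ^ 2 ∧
        wc i / (cf / (((ℓ + 1 : ℕ) : ℝ) ^ j0 hMh1 hP4 c)) ^ 2 ≤ a₁ * ((((ℓ + 1 : ℕ) : ℝ)) ^ j0 hMh1 hP4 c) ^ (d + 1)) :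
    onFun (dcsE (P := PV d ℓ m K hd hL) cf ∘ₗ dcE cf + dE cf ∘ₗ dsE cf +
        QsE (domT hN (D.chart (svec ℓ k c.1.1 c.1.2)) hk) ∘ₗ aE (domT hN (D.chart (svec ℓ k c.1.1 c.1.2)) hk) wc ∘ₗ
          QE (domT hN (D.chart (svec ℓ k c.1.1 c.1.2)) hk)) * mulOp (hch hN hMh1 hP4 c) =
      MlC hN hk hMh1 hP4 hMha c ha hpl wc cf * mulOp (hch hN hMh1 hP4 c) := by
  have hk1 : 1 ≤ k := by omega
  have hjl := jmin_le_level hMh1 hP4 c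
  rw [MlC, smul_mul_assoc]
  exact hagree_tOf hN (D.chart (svec ℓ k c.1.1 c.1.2)) hk wc hcf (eC a c.1.1) 0 (j0 hMh1 hP4 c) (j0_hj hMh1 hP4 c a) ha (hx0 hpl)
    (hfit hN hMh1 hP4 hMha c ha hpl) (r := 4 * (ℓ + 1) ^ (j0 hMh1 hP4 c + 1)) (j0_succ_le hMh1 hP4 c hk1)
    (fun μ => pow_dvd_x0 ℓ Mh k c.1 (by unfold j0; omega) μ) le_rfl (hlev_deep hN hMh1 hP4 hMha c ha hR2)
    (hfar_cube hN hk hMh1 hP4 hMha c ha hR2 _) hband (hch hN hMh1 hP4 c) (fun b hb => hch_deep hN hMh1 hP4 hMha c ha hM8 hR2 hb)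

/-- **(hinvl) IN THE CHART FRAME**: `(M_□ − P_□)·G_□·h_□ = h_□` (`a₀ > 0`, `c′ ≠ 0`; `supp h_□` in the window). [cite: Balaban1984PropagatorsII, (2.94) p.239, (2.90)–(2.91) p.239] -/
theorem hinvlC (ha₀ : 0 < a₀) (hM8 : 8 ≤ Mh) (hR2 : 2 * (ℓ + 1) ^ 2 ≤ R) (hpl : Placed ℓ k P' c.1)
    (wc : BondIdx (domT hN (D.chart (svec ℓ k c.1.1 c.1.2)) hk) → ℝ) {cf : ℝ} (hcf : cf ≠ 0) :
    (MlC hN hk hMh1 hP4 hMha c ha hpl wc cf - PlC hN hk hMh1 hP4 hMha c ha hpl wc cf) * GlC hN hk hMh1 hP4 hMha c ha hpl wc cf *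
        mulOp (hch hN hMh1 hP4 c) = mulOp (hch hN hMh1 hP4 c) := by
  rw [MlC, PlC, GlC]
  exact hinvl_GlV1_scaled ha₀ hN (sc_ne_zero hMh1 hP4 c hcf) (hch hN hMh1 hP4 c)
    (fun b hb => mem_cB_W.2 (hch_deep0 hN hMh1 hP4 hMha c ha hM8 hR2 hb))

/-- a local majorant scales: `s • T` has the local majorant `|s|·K`. [folklore] -/
private theorem localMajorant_smul {g : B6.Geometry} {X : Type} (blk' : X → g.Site) {T : Module.End ℝ (X → ℝ)} {S : Set g.Site}
    {K : g.Site → g.Site → ℝ} (h : LocalMajorant blk' T S K) (s : ℝ) : LocalMajorant blk' (s • T) S (fun a b => |s| * K a b) := by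
  intro y' hy' μ B hμ x hx
  rw [LinearMap.smul_apply, Pi.smul_apply, smul_eq_mul, abs_mul, mul_assoc]
  exact mul_le_mul_of_nonneg_left (h y' hy' μ B hμ x hx) (abs_nonneg _)

/-- a local majorant is monotone in the kernel ON THE REACH SET. [folklore] -/
private theorem localMajorant_mono_on {g : B6.Geometry} {X : Type} (blk' : X → g.Site) {T : Module.End ℝ (X → ℝ)} {S : Set g.Site}
    {K K' : g.Site → g.Site → ℝ} (h : LocalMajorant blk' T S K) (hle : ∀ a ∈ S, ∀ b ∈ S, K a b ≤ K' a b) : LocalMajorant blk' T S K' :=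
  fun y' hy' μ B hμ x hx => (h y' hy' μ B hμ x hx).trans (mul_le_mul_of_nonneg_right (hle _ hx _ hy') hμ.nonneg)

/-- **THE CHART-FRAME REACH SET `□⁺`** of the central cube as a set of sites of `geomT (D.chart s_□)` (its image under p21's block map is the skeleton's
`ST D c = Q^T_□`). [cite: Balaban1984PropagatorsII, p.235, (2.133) p.247] -/
def SQ : Set (geomT (D.chart (svec ℓ k c.1.1 c.1.2))).Site := {y | y ∈ Q (Dch D c) (cc D hMh1 hP4 c)}

/-- membership in `SQ`. [cite: Balaban1984PropagatorsII, p.235, dictionary] -/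
@[simp] theorem mem_SQ (y : (geomT (D.chart (svec ℓ k c.1.1 c.1.2))).Site) : y ∈ SQ hMh1 hP4 c ↔ y ∈ Q (Dch D c) (cc D hMh1 hP4 c) := Iff.rfl

/-- **(2.133) IN THE CHART FRAME WITH PRINT'S PREFACTOR**: if the full-window transplant `GlV1` of the member's `G` has a local majorant
`C·e^{−σ d_T}` on `□⁺` (the output of `B6FullWindowReachV1L0.reach2133_G_V1_full` for this cube), then `G_□ = s(□)⁻¹•GlV1` has the local majorant
`C·(L^{j(y)}/c′)²·e^{−σ d_T}` there (`s(□)⁻¹ = (L^{j₀}/c′)² ≤ (L^{j(y)}/c′)²` on `□⁺`, whose blocks have level `≥ j₀`).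
[cite: Balaban1984PropagatorsII, (2.133) p.247, (2.94) p.239, Prop. 2.6 (2.136) p.247 («C(L^jη)²»)] -/
theorem h2133C (hMh : 2 ≤ Mh) (hR2 : 2 * (ℓ + 1) ^ 2 ≤ R) (hpl : Placed ℓ k P' c.1)
    (wc : BondIdx (domT hN (D.chart (svec ℓ k c.1.1 c.1.2)) hk) → ℝ) (cf : ℝ) {C σ : ℝ} (hC : 0 ≤ C)
    (hG : LocalMajorant (g := geomT (D.chart (svec ℓ k c.1.1 c.1.2))) (blkV1 hN (D.chart (svec ℓ k c.1.1 c.1.2)))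
      (GlV1 (tC hN hk hMh1 hP4 c ha a wc cf) hN
        (cB (tC hN hk hMh1 hP4 c ha a wc cf) (x0 ℓ Mh k c.1) (hx0 hpl) (hfit hN hMh1 hP4 hMha c ha hpl)).W (x0 ℓ Mh k c.1))
      (SQ hMh1 hP4 c) (fun a b => C * Real.exp (-(σ * (geomT (D.chart (svec ℓ k c.1.1 c.1.2))).dist a b)))) :
    LocalMajorant (g := geomT (D.chart (svec ℓ k c.1.1 c.1.2))) (blkV1 hN (D.chart (svec ℓ k c.1.1 c.1.2)))
      (GlC hN hk hMh1 hP4 hMha c ha hpl wc cf) (SQ hMh1 hP4 c)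
      (fun a b => C * pref cf a * Real.exp (-(σ * (geomT (D.chart (svec ℓ k c.1.1 c.1.2))).dist a b))) := by
  rw [GlC]
  refine localMajorant_mono_on _ (localMajorant_smul _ hG _) fun y hy b _ => ?_
  have hlev := j0_le_of_mem_Q hMh1 hP4 c hMh hR2 hL ((mem_SQ hMh1 hP4 c y).1 hy)
  rw [sc_inv, abs_of_nonneg (sq_nonneg _)]
  have hL1 : (1 : ℝ) ≤ ((ℓ + 1 : ℕ) : ℝ) := by exact_mod_cast Nat.succ_pos ℓ
  have hpow : (((ℓ + 1 : ℕ) : ℝ)) ^ j0 hMh1 hP4 c ≤ (((ℓ + 1 : ℕ) : ℝ)) ^ y.1.1 := pow_le_pow_right₀ hL1 hlev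
  have hsq : ((((ℓ + 1 : ℕ) : ℝ)) ^ j0 hMh1 hP4 c / cf) ^ 2 ≤ pref cf y := by
    unfold pref
    rw [div_pow, div_pow]
    by_cases hcf : cf = 0
    · simp [hcf]
    · exact div_le_div_of_nonneg_right (pow_le_pow_left₀ (by positivity) hpow 2) (by positivity)
  have he : 0 ≤ Real.exp (-(σ * (geomT (D.chart (svec ℓ k c.1.1 c.1.2))).dist y b)) := Real.exp_nonneg _
  calc ((((ℓ + 1 : ℕ) : ℝ)) ^ j0 hMh1 hP4 c / cf) ^ 2 * (C * Real.exp (-(σ * (geomT (D.chart (svec ℓ k c.1.1 c.1.2))).dist y b)))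
      = C * ((((ℓ + 1 : ℕ) : ℝ)) ^ j0 hMh1 hP4 c / cf) ^ 2 * Real.exp (-(σ * (geomT (D.chart (svec ℓ k c.1.1 c.1.2))).dist y b)) := by ring
    _ ≤ C * pref cf y * Real.exp (-(σ * (geomT (D.chart (svec ℓ k c.1.1 c.1.2))).dist y b)) :=
      mul_le_mul_of_nonneg_right (mul_le_mul_of_nonneg_left hsq hC) he

end Defs

end Members

/-! ## §6  Back to the global frame: the members `G_□, M_□, P_□` of the cube are the conjugates `τ_{−v}·(chart-frame members)·τ_v`, `v = (M·L^k)·s_□`;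
(hagree), (hinvl), (2.133) for the skeleton's `h_□ = hB` and `Q^T_□ = ST` -/

section Global

open B6SectAOperatorsV1 (dE dsE dcE dcsE QE aE QsE BondIdx)
open B6Prop26Gluing (mulOp LocalMajorant)
open B6Ineq2133TwoScaleV1 (onFun)
open B6AgreeLapV1Chart (cB)
open B6AgreeQaQV1Chart (NearB)
open B6GlobalChartV1 (GlV1)
open B6Geom246MultiLevelTorusL0 (geomT blkMap)
open B6TranslateV1 (tv trV trV_apply)
open B6TranslateTorusV1 (vch TB TB_mul_TB_neg mulOp_eq_conj toBox_add_tv)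
open B6TranslateTorusV1L0 (onFun_localPart_eq_conj localMajorant_conj_chart kernel_blkMap isTr_domT_chart)
open B6Prop26KLevelSkeletonV1L0 (hB hB_apply ST mem_ST pref)
open B6Partition118KLevelTorusCentralL0 (QT)

variable (hN : ∀ μ, N0 ℓ Mh k P' μ = (PV d ℓ m K hd hL).sitesPerDir 0) {D : TDomains d ℓ Mh k P' R} (hk : k ≤ m + K)
  (hMh1 : 1 ≤ Mh) (hP4 : ∀ μ, 4 ≤ P' μ) {a : ℕ} (hMha : Mh = (ℓ + 1) ^ a) (c : ↥(cubes D.toDomains)) (ha : a₀ ≤ a₁)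

/-- **THE CHART-FRAME WEIGHTS**: the global weights pulled back along the index correspondence `𝔅(Ω − v) ≃ 𝔅(Ω)` of the chart.
[cite: Balaban1984PropagatorsII, (2.16) p.225, dictionary (charts)] -/
abbrev wC (w : BondIdx (domT hN D hk) → ℝ) : BondIdx (domT hN (D.chart (svec ℓ k c.1.1 c.1.2)) hk) → ℝ :=
  w ∘ (isTr_domT_chart hN D hk (svec ℓ k c.1.1 c.1.2)).idxB

/-- **THE SKELETON'S `h_□` TRANSLATED BY THE CHART VECTOR IS THE CHART-FRAME `h_□`**: `τ_v hB = hch` (`h^T_□ = h^F_{cc} ∘ σ_□⁻¹`, p38's `hT_eq_hF_cc`).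
[cite: Balaban1984PropagatorsII, (2.36) p.229, dictionary (charts)] -/
theorem trV_hB : trV (vch Mh k (svec ℓ k c.1.1 c.1.2)) (hB hN D c) = hch hN hMh1 hP4 c := by
  funext b
  rw [trV_apply, hB_apply, hch_apply, PBond.translate_src, toBox_add_tv, hT_eq_hF_cc hMh1 hP4 c]
  congr 1
  exact (σch D c).symm_apply_apply _

/-- conjugates multiply. [cite: Balaban1984PropagatorsII, (2.19)–(2.22) p.226, dictionary] -/
private theorem conj_mul (v : Site (PV d ℓ m K hd hL) 0) (A B : Module.End ℝ (PBond (PV d ℓ m K hd hL) 0 → ℝ)) :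
    (TB (-v) * A * TB v) * (TB (-v) * B * TB v) = TB (-v) * (A * B) * TB v := by
  simp only [mul_assoc]
  rw [← mul_assoc (TB v) (TB (-v)), TB_mul_TB_neg, one_mul]

/-- conjugates subtract. [cite: Balaban1984PropagatorsII, (2.19) p.226, dictionary] -/
private theorem conj_sub (v : Site (PV d ℓ m K hd hL) 0) (A B : Module.End ℝ (PBond (PV d ℓ m K hd hL) 0 → ℝ)) :
    TB (-v) * A * TB v - TB (-v) * B * TB v = TB (-v) * (A - B) * TB v := by
  rw [mul_sub, sub_mul]

/-- **`G_□` OF THE CUBE ON THE GLOBAL TORUS**: the conjugate of the chart-frame `G_□`. [cite: Balaban1984PropagatorsII, (2.90)–(2.91) p.239, dictionary (charts)] -/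
def Gl (hpl : Placed ℓ k P' c.1) (w : BondIdx (domT hN D hk) → ℝ) (cf : ℝ) : Module.End ℝ (PBond (PV d ℓ m K hd hL) 0 → ℝ) :=
  TB (-vch Mh k (svec ℓ k c.1.1 c.1.2)) * GlC hN hk hMh1 hP4 hMha c ha hpl (wC hN hk c w) cf * TB (vch Mh k (svec ℓ k c.1.1 c.1.2))

/-- **`M_□` OF THE CUBE ON THE GLOBAL TORUS**. [cite: Balaban1984PropagatorsII, (2.91) p.239, dictionary (charts)] -/
def Ml (hpl : Placed ℓ k P' c.1) (w : BondIdx (domT hN D hk) → ℝ) (cf : ℝ) : Module.End ℝ (PBond (PV d ℓ m K hd hL) 0 → ℝ) :=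
  TB (-vch Mh k (svec ℓ k c.1.1 c.1.2)) * MlC hN hk hMh1 hP4 hMha c ha hpl (wC hN hk c w) cf * TB (vch Mh k (svec ℓ k c.1.1 c.1.2))

/-- **`P_□` OF THE CUBE ON THE GLOBAL TORUS**. [cite: Balaban1984PropagatorsII, (2.91) p.239, dictionary (charts)] -/
def Pl (hpl : Placed ℓ k P' c.1) (w : BondIdx (domT hN D hk) → ℝ) (cf : ℝ) : Module.End ℝ (PBond (PV d ℓ m K hd hL) 0 → ℝ) :=
  TB (-vch Mh k (svec ℓ k c.1.1 c.1.2)) * PlC hN hk hMh1 hP4 hMha c ha hpl (wC hN hk c w) cf * TB (vch Mh k (svec ℓ k c.1.1 c.1.2))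

/-- **(hagree) OF THE SKELETON FOR THE CUBE**: `M·h_□ = M_□·h_□` with the local part `M = ∂*∂ + ∂∂* + Q*aQ` of the GLOBAL `Δ_a` (weights `w`) and
the skeleton's `h_□ = hB` — the chart-frame identity conjugated (`B6TranslateTorusV1L0.onFun_localPart_eq_conj`, `mulOp_eq_conj`).
[cite: Balaban1984PropagatorsII, (2.89)–(2.91) p.239, (2.19) p.226] -/
theorem hagree_cube (hk2 : 2 ≤ k) (hM8 : 8 ≤ Mh) (hR2 : 2 * (ℓ + 1) ^ 2 ≤ R) (hpl : Placed ℓ k P' c.1)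
    (w : BondIdx (domT hN D hk) → ℝ) {cf : ℝ} (hcf : cf ≠ 0)
    (hband : ∀ i : BondIdx (domT hN (D.chart (svec ℓ k c.1.1 c.1.2)) hk), ((i.1.1 : ℕ) = j0 hMh1 hP4 c ∨ (i.1.1 : ℕ) = j0 hMh1 hP4 c + 1) →
      NearB (bare d ℓ hd hL (eC a c.1.1) 0 (j0 hMh1 hP4 c) (j0_hj hMh1 hP4 c a) ha) (x0 ℓ Mh k c.1) (4 * (ℓ + 1) ^ (j0 hMh1 hP4 c + 1)) i.1.1 i.1.2 →
      a₀ * ((((ℓ + 1 : ℕ) : ℝ)) ^ j0 hMh1 hP4 c) ^ (d + 1) ≤ wC hN hk c w i / (cf / (((ℓ + 1 : ℕ) : ℝ) ^ j0 hMh1 hP4 c)) ^ 2 ∧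
        wC hN hk c w i / (cf / (((ℓ + 1 : ℕ) : ℝ) ^ j0 hMh1 hP4 c)) ^ 2 ≤ a₁ * ((((ℓ + 1 : ℕ) : ℝ)) ^ j0 hMh1 hP4 c) ^ (d + 1)) :
    onFun (dcsE (P := PV d ℓ m K hd hL) cf ∘ₗ dcE cf + dE cf ∘ₗ dsE cf + QsE (domT hN D hk) ∘ₗ aE (domT hN D hk) w ∘ₗ QE (domT hN D hk)) *
        mulOp (hB hN D c) = Ml hN hk hMh1 hP4 hMha c ha hpl w cf * mulOp (hB hN D c) := by
  rw [onFun_localPart_eq_conj hN D hk (svec ℓ k c.1.1 c.1.2) cf w, mulOp_eq_conj (vch Mh k (svec ℓ k c.1.1 c.1.2)) (hB hN D c),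
    trV_hB hN hMh1 hP4 c, Ml, conj_mul, conj_mul, hagreeC hN hk hMh1 hP4 hMha c ha hk2 hM8 hR2 hpl (wC hN hk c w) hcf hband]

/-- **(hinvl) OF THE SKELETON FOR THE CUBE**: `(M_□ − P_□)·G_□·h_□ = h_□` on the global torus. [cite: Balaban1984PropagatorsII, (2.94) p.239, (2.90)–(2.91) p.239] -/
theorem hinvl_cube (ha₀ : 0 < a₀) (hM8 : 8 ≤ Mh) (hR2 : 2 * (ℓ + 1) ^ 2 ≤ R) (hpl : Placed ℓ k P' c.1)
    (w : BondIdx (domT hN D hk) → ℝ) {cf : ℝ} (hcf : cf ≠ 0) :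
    (Ml hN hk hMh1 hP4 hMha c ha hpl w cf - Pl hN hk hMh1 hP4 hMha c ha hpl w cf) * Gl hN hk hMh1 hP4 hMha c ha hpl w cf * mulOp (hB hN D c) =
      mulOp (hB hN D c) := by
  rw [mulOp_eq_conj (vch Mh k (svec ℓ k c.1.1 c.1.2)) (hB hN D c), trV_hB hN hMh1 hP4 c, Ml, Pl, Gl, conj_sub, conj_mul, conj_mul,
    hinvlC hN hk hMh1 hP4 hMha c ha ha₀ hM8 hR2 hpl (wC hN hk c w) hcf]

/-- `Q^T_□` is the block-map image of the chart-frame `□⁺`. [cite: Balaban1984PropagatorsII, p.235, (2.133) p.247, dictionary (charts)] -/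
theorem mem_blkMap_image_SQ (y : ↥(bset D.toDomains)) : y ∈ blkMap D (svec ℓ k c.1.1 c.1.2) '' SQ hMh1 hP4 c ↔ y ∈ ST D hMh1 hP4 c := by
  constructor
  · rintro ⟨x, hx, rfl⟩
    show blkMap D (svec ℓ k c.1.1 c.1.2) x ∈ (Q (Dch D c) (cc D hMh1 hP4 c)).image (blkMap D (svec ℓ k c.1.1 c.1.2))
    exact Finset.mem_image_of_mem _ hx
  · intro hy
    obtain ⟨x, hx, hxy⟩ := Finset.mem_image.1 (show y ∈ QT D hMh1 hP4 c from hy)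
    exact ⟨x, hx, hxy⟩

/-- a local majorant on a reach set is one on any set with the same members. [folklore] -/
private theorem localMajorant_congr_set {g : B6.Geometry} {X : Type} (blk' : X → g.Site) {T : Module.End ℝ (X → ℝ)} {S S' : Set g.Site}
    {K : g.Site → g.Site → ℝ} (hS : ∀ a, a ∈ S ↔ a ∈ S') (h : LocalMajorant blk' T S K) : LocalMajorant blk' T S' K :=
  fun y' hy' μ B hμ x hx => h y' ((hS y').2 hy') μ B hμ x ((hS _).2 hx)

/-- **(2.133) OF THE SKELETON FOR THE CUBE**: if the full-window transplant of the member's `G` has the local majorant `C·e^{−σd_T}` on the chart-frame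
`□⁺` (the output of `reach2133_G_V1_full`), then `G_□` has the local majorant `C·(L^{j(y)}/c′)²·e^{−σ d_T}` on `Q^T_□` of the global torus
(`h2133C` transported by `B6TranslateTorusV1L0.localMajorant_conj_chart`; distances and levels are chart-invariant).
[cite: Balaban1984PropagatorsII, (2.133) p.247, (2.46) p.231, Prop. 2.6 (2.136) p.247] -/
theorem h2133_cube (hMh : 2 ≤ Mh) (hR2 : 2 * (ℓ + 1) ^ 2 ≤ R) (hpl : Placed ℓ k P' c.1) (w : BondIdx (domT hN D hk) → ℝ) (cf : ℝ)
    {C σ : ℝ} (hC : 0 ≤ C)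
    (hG : LocalMajorant (g := geomT (D.chart (svec ℓ k c.1.1 c.1.2))) (blkV1 hN (D.chart (svec ℓ k c.1.1 c.1.2)))
      (GlV1 (tC hN hk hMh1 hP4 c ha a (wC hN hk c w) cf) hN
        (cB (tC hN hk hMh1 hP4 c ha a (wC hN hk c w) cf) (x0 ℓ Mh k c.1) (hx0 hpl) (hfit hN hMh1 hP4 hMha c ha hpl)).W (x0 ℓ Mh k c.1))
      (SQ hMh1 hP4 c) (fun a b => C * Real.exp (-(σ * (geomT (D.chart (svec ℓ k c.1.1 c.1.2))).dist a b)))) :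
    LocalMajorant (g := geomT D) (blkV1 hN D) (Gl hN hk hMh1 hP4 hMha c ha hpl w cf) (ST D hMh1 hP4 c)
      (fun a b => C * pref cf a * Real.exp (-(σ * (geomT D).dist a b))) := by
  have hP : ∀ μ, 1 ≤ P' μ := one_le_of_four_le hP4
  have h := localMajorant_conj_chart hN D hMh1 hP (svec ℓ k c.1.1 c.1.2)
    (K' := fun a b => C * pref cf a * Real.exp (-(σ * (geomT D).dist a b)))
    (h2133C hN hk hMh1 hP4 hMha c ha hMh hR2 hpl (wC hN hk c w) cf hC hG)
    (fun a b => le_of_eq (kernel_blkMap D hMh1 hP (svec ℓ k c.1.1 c.1.2) (fun n => ((((ℓ + 1 : ℕ) : ℝ)) ^ n / cf) ^ 2) C σ a b))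
  exact localMajorant_congr_set _ (mem_blkMap_image_SQ hMh1 hP4 c) h

end Global

/-! ## §7  THE k-LEVEL (2.136)₁ WITH THE MEMBERS OF THE CUBES: the skeleton's (h2133), (hagree), (hinvl) DISCHARGED -/

section Assembly

open B6SectAOperatorsV1 (dE dsE dcE dcsE QE aE QsE RE BondIdx)
open B6SectAVectorModelV1 (GE)
open B6Prop26Gluing (mulOp LocalMajorant OutLoc)
open B6Ineq2133TwoScaleV1 (onFun)
open B6RandomWalk (HasMajorant delta3)
open B6Ineq261LevelGap (K261)
open B6Eq291Generator (kFam)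
open B6AgreeLapV1Chart (cB)
open B6AgreeQaQV1Chart (NearB)
open B6GlobalChartV1 (GlV1)
open B6Geom246MultiLevelTorusL0 (geomT)
open B6FullWindowReachV1L0 (reach2133_G_V1_full)
open B6Prop26KLevelSkeletonV1L0 (hB zB ST pref prop26_2136_kLevel_skeleton)

open Classical in
/-- **PROPOSITION 2.6, ENTRY (2.136)₁, k LEVELS, WITH THE MEMBERS OF THE CUBES** (B6-CLOSURE §5 item 13 (iii)+(iv)): there are `δ > 0`, `A ≥ 0`
(on `d, L, a₀, a₁`) such that for every V1 global torus carrying p21's torus family `D` (`hN`, `k ≤ m + K`, `k ≥ 2`, `M_h = L^a ≥ 8`, `R ≥ 2L²`,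
`P′_μ ≥ 5`, every cube placed — automatic below the top level, `placed_of_lt`), every Lemma-2.1 budget, fine factor `c′ ≠ 0` and positive weights `w`
of the GLOBAL `Δ_a` whose chart-frame pull-backs lie in the band `[a₀, a₁]` near each cube's window (`hband`), overlap bound `Nov` of the `Q^T_□`, and
the (2.134) majorant + output localisation + smallness for the (2.91)-family BUILT FROM THIS FILE'S MEMBERS `G_□ = Gl`, `M_□ = Ml`, `P_□ = Pl` (the
conjugated scaled transplants of the two-scale members `t(□)` of the cubes) — the genuine `G = Δ_a⁻¹ = GE (domT hN D hk)` has the majorant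
`(Nov·A)·c₁·(1 − Nov²θ₀c₁)⁻¹·(L^{j(y)}/c′)²·e^{−δ₃ d_T(y,y′)}`: the skeleton `prop26_2136_kLevel_skeleton` with its per-cube (h2133) (`reach2133_G_V1_full` +
`h2133_cube`), (hagree) (`hagree_cube`) and (hinvl) (`hinvl_cube`) DISCHARGED. [cite: Balaban1984PropagatorsII, Prop. 2.6 (2.136) p.247, (2.133)–(2.134) p.247, (2.89)–(2.94) p.239, p.238] -/
theorem prop26_2136_kLevel_cubes (d ℓ : ℕ) (hd : 1 ≤ d + 1) (hL : Odd (ℓ + 1) ∧ 1 < ℓ + 1) {a₀ a₁ : ℝ} (ha₀ : 0 < a₀) (ha₁ : a₀ ≤ a₁) :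
    ∃ δ : ℝ, 0 < δ ∧ ∃ A : ℝ, 0 ≤ A ∧ ∀ (m K : ℕ) {Mh k R : ℕ} {P' : Fin (d + 1) → ℕ}
      (hN : ∀ μ, N0 ℓ Mh k P' μ = (PV d ℓ m K hd hL).sitesPerDir 0) (D : TDomains d ℓ Mh k P' R) (hk : k ≤ m + K) (_ : 2 ≤ k)
      {a : ℕ} (hMha : Mh = (ℓ + 1) ^ a) (hM8 : 8 ≤ Mh) (_ : 2 * (ℓ + 1) ^ 2 ≤ R) (hP5 : ∀ μ, 5 ≤ P' μ)
      (hpl : ∀ c : ↥(cubes D.toDomains), Placed ℓ k P' c.1)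
      (α : ℝ) (_ : 0 ≤ α) (_ : α ≤ 1) (N₀ : ℕ) (_ : 0 < N₀) (_ : N₀ + 1 ≤ R * ((ℓ + 1) * Mh))
      (_ : Real.exp (-(α * (δ / (d + 1)))) * ((ℓ : ℝ) + 1) ^ ((2 * (d + 1 : ℕ) : ℝ) / N₀) < 1)
      {cf : ℝ} (hcf : cf ≠ 0) {w : BondIdx (domT hN D hk) → ℝ} (hw : ∀ i, 0 < w i)
      (_ : ∀ (c : ↥(cubes D.toDomains)) (i : BondIdx (domT hN (D.chart (svec ℓ k c.1.1 c.1.2)) hk)),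
        ((i.1.1 : ℕ) = j0 (one_le_of_eight_le hM8) (four_le_of_five_le hP5) c ∨
          (i.1.1 : ℕ) = j0 (one_le_of_eight_le hM8) (four_le_of_five_le hP5) c + 1) →
        NearB (bare d ℓ hd hL (eC a c.1.1) 0 (j0 (one_le_of_eight_le hM8) (four_le_of_five_le hP5) c)
          (j0_hj (one_le_of_eight_le hM8) (four_le_of_five_le hP5) c a) ha₁) (x0 ℓ Mh k c.1)
          (4 * (ℓ + 1) ^ (j0 (one_le_of_eight_le hM8) (four_le_of_five_le hP5) c + 1)) i.1.1 i.1.2 →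
        a₀ * ((((ℓ + 1 : ℕ) : ℝ)) ^ j0 (one_le_of_eight_le hM8) (four_le_of_five_le hP5) c) ^ (d + 1) ≤
            wC hN hk c w i / (cf / (((ℓ + 1 : ℕ) : ℝ) ^ j0 (one_le_of_eight_le hM8) (four_le_of_five_le hP5) c)) ^ 2 ∧
          wC hN hk c w i / (cf / (((ℓ + 1 : ℕ) : ℝ) ^ j0 (one_le_of_eight_le hM8) (four_le_of_five_le hP5) c)) ^ 2 ≤
            a₁ * ((((ℓ + 1 : ℕ) : ℝ)) ^ j0 (one_le_of_eight_le hM8) (four_le_of_five_le hP5) c) ^ (d + 1))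
      (Nov : ℕ) (_ : ∀ y : (geomT D).Site, (Finset.univ.filter fun c : ↥(cubes D.toDomains) =>
        y ∈ ST D (one_le_of_eight_le hM8) (four_le_of_five_le hP5) c).card ≤ Nov)
      (θ₀ : ℝ) (_ : 0 ≤ θ₀)
      (_ : ∀ c c', HasMajorant (g := geomT D) (blkV1 hN D)
        ((kFam (onFun (dE (P := PV d ℓ m K hd hL) cf ∘ₗ (LinearMap.id - RE (domT hN D hk) cf) ∘ₗ dsE cf))
            (fun c => mulOp (hB hN D c)) (fun c => mulOp (zB hN D (one_le_of_eight_le hM8) (four_le_of_five_le hP5) c))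
            (fun c => Ml hN hk (one_le_of_eight_le hM8) (four_le_of_five_le hP5) hMha c ha₁ (hpl c) w cf)
            (fun c => Pl hN hk (one_le_of_eight_le hM8) (four_le_of_five_le hP5) hMha c ha₁ (hpl c) w cf) c c' *
          Gl hN hk (one_le_of_eight_le hM8) (four_le_of_five_le hP5) hMha c' ha₁ (hpl c') w cf) * mulOp (hB hN D c'))
        (fun y y' => θ₀ * Real.exp (-((2 * (δ / (d + 1))) / 2 * (geomT D).dist y y'))))
      (_ : ∀ c c', OutLoc (g := geomT D) (blkV1 hN D)
        (kFam (onFun (dE (P := PV d ℓ m K hd hL) cf ∘ₗ (LinearMap.id - RE (domT hN D hk) cf) ∘ₗ dsE cf))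
            (fun c => mulOp (hB hN D c)) (fun c => mulOp (zB hN D (one_le_of_eight_le hM8) (four_le_of_five_le hP5) c))
            (fun c => Ml hN hk (one_le_of_eight_le hM8) (four_le_of_five_le hP5) hMha c ha₁ (hpl c) w cf)
            (fun c => Pl hN hk (one_le_of_eight_le hM8) (four_le_of_five_le hP5) hMha c ha₁ (hpl c) w cf) c c' *
          Gl hN hk (one_le_of_eight_le hM8) (four_le_of_five_le hP5) hMha c' ha₁ (hpl c') w cf)
        (ST D (one_le_of_eight_le hM8) (four_le_of_five_le hP5) c))
      (_ : (Nov : ℝ) ^ 2 * θ₀ * K261 N₀ (d + 1) ((ℓ : ℝ) + 1) 1 (α * (δ / (d + 1))) < 1),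
      HasMajorant (g := geomT D) (blkV1 hN D) (onFun (GE (domT hN D hk) hcf hw))
        (fun y y' => (Nov * A) * K261 N₀ (d + 1) ((ℓ : ℝ) + 1) 1 (α * (δ / (d + 1))) *
          (1 - (Nov : ℝ) ^ 2 * θ₀ * K261 N₀ (d + 1) ((ℓ : ℝ) + 1) 1 (α * (δ / (d + 1))))⁻¹ * pref cf y *
          Real.exp (-(delta3 α (2 * (δ / (d + 1))) * (geomT D).dist y y'))) := by
  obtain ⟨δ, hδ, A, hA, hreach⟩ := reach2133_G_V1_full d ℓ hd hL ha₀ ha₁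
  refine ⟨δ, hδ, ((ℓ + 1) ^ (d + 1) : ℕ) * (A * Real.exp (δ * ((d + 1 : ℝ) + (d + 1)) / (d + 1))), by positivity, ?_⟩
  intro m K Mh k R P' hN D hk hk2 a hMha hM8 hR2 hP5 hpl α hα0 hα1 N₀ hN₀ hRM hθ cf hcf w hw hband Nov hNov θ₀ hθ₀ h2134 hKout hsmall
  have hMh1 : 1 ≤ Mh := one_le_of_eight_le hM8
  have hP4 : ∀ μ, 4 ≤ P' μ := four_le_of_five_le hP5
  have hP : ∀ μ, 1 ≤ P' μ := one_le_of_four_le hP4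
  have hMh : 2 ≤ Mh := le_trans (by norm_num) hM8
  have hR : 2 * (ℓ + 1) ≤ R := le_trans (by nlinarith : 2 * (ℓ + 1) ≤ 2 * (ℓ + 1) ^ 2) hR2
  have e22 : (2 * (δ / ((d : ℝ) + 1))) / 2 = δ / ((d : ℝ) + 1) := by ring
  -- (2.133) per cube: the reach majorant of the full-window transplant in the chart, scaled and conjugated
  have h2133 : ∀ c : ↥(cubes D.toDomains), LocalMajorant (g := geomT D) (blkV1 hN D) (Gl hN hk hMh1 hP4 hMha c ha₁ (hpl c) w cf) (ST D hMh1 hP4 c)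
      (fun y y' => ((ℓ + 1) ^ (d + 1) : ℕ) * (A * Real.exp (δ * ((d + 1 : ℝ) + (d + 1)) / (d + 1))) * pref cf y *
        Real.exp (-((2 * (δ / (d + 1))) / 2 * (geomT D).dist y y'))) := by
    intro c
    have hG := hreach (tC hN hk hMh1 hP4 c ha₁ a (wC hN hk c w) cf) m K hN (D.chart (svec ℓ k c.1.1 c.1.2)) hMh1 hP (x0 ℓ Mh k c.1)
      (hx0 (hpl c)) (hfit hN hMh1 hP4 hMha c ha₁ (hpl c))
      (fun μ => pow_dvd_x0 ℓ Mh k c.1 (by have := jmin_le_level hMh1 hP4 c; show j0 hMh1 hP4 c ≤ c.1.1 + 1; unfold j0; omega) μ)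
      ((ℓ + 1) ^ eC a c.1.1) (by show (ℓ + 1) ^ eC a c.1.1 ≤ (ℓ + 1) ^ (eC a c.1.1 + 0); simp)
      (hlev_window hMh1 hP4 hMha c hL hR2) (SQ hMh1 hP4 c) (fun b hb => inWindow_of_blk_mem_Q hN hMh1 hP4 hMha c hMh hR b hb)
    have hG' : LocalMajorant (g := geomT (D.chart (svec ℓ k c.1.1 c.1.2))) (blkV1 hN (D.chart (svec ℓ k c.1.1 c.1.2)))
        (GlV1 (tC hN hk hMh1 hP4 c ha₁ a (wC hN hk c w) cf) hN
          (cB (tC hN hk hMh1 hP4 c ha₁ a (wC hN hk c w) cf) (x0 ℓ Mh k c.1) (hx0 (hpl c)) (hfit hN hMh1 hP4 hMha c ha₁ (hpl c))).W (x0 ℓ Mh k c.1))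
        (SQ hMh1 hP4 c) (fun y y' => ((ℓ + 1) ^ (d + 1) : ℕ) * (A * Real.exp (δ * ((d + 1 : ℝ) + (d + 1)) / (d + 1))) *
          Real.exp (-(δ / (d + 1) * (geomT (D.chart (svec ℓ k c.1.1 c.1.2))).dist y y'))) :=
      localMajorant_mono_on _ hG fun y _ y' _ => le_of_eq (by ring)
    have h := h2133_cube hN hk hMh1 hP4 hMha c ha₁ hMh hR2 (hpl c) w cf (by positivity) hG'
    exact localMajorant_mono_on _ h fun y _ y' _ => by rw [e22]
  exact prop26_2136_kLevel_skeleton hN D hk hMh hR hP5 hδ (by positivity) α hα0 hα1 N₀ hN₀ hRM hθ hcf hw Nov hNov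
    (fun c => Gl hN hk hMh1 hP4 hMha c ha₁ (hpl c) w cf) (fun c => Ml hN hk hMh1 hP4 hMha c ha₁ (hpl c) w cf)
    (fun c => Pl hN hk hMh1 hP4 hMha c ha₁ (hpl c) w cf) h2133
    (fun c => hagree_cube hN hk hMh1 hP4 hMha c ha₁ hk2 hM8 hR2 (hpl c) w hcf (hband c))
    (fun c => hinvl_cube hN hk hMh1 hP4 hMha c ha₁ ha₀ hM8 hR2 (hpl c) w hcf) θ₀ hθ₀ h2134 hKout hsmall

end Assembly

/-! ## §8  The weight band: a GLOBAL band on the weights of `Δ_a` gives the chart-frame member band of every cube -/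

section Band

open B6SectAOperatorsV1 (dE dsE dcE dcsE QE aE QsE RE BondIdx)
open B6SectAVectorModelV1 (GE)
open B6Prop26Gluing (mulOp LocalMajorant OutLoc)
open B6Ineq2133TwoScaleV1 (onFun)
open B6RandomWalk (HasMajorant delta3)
open B6Ineq261LevelGap (K261)
open B6Eq291Generator (kFam)
open B6AgreeQaQV1Chart (NearB)
open B6Geom246MultiLevelTorusL0 (geomT)
open B6TranslateV1 (IsTr)
open B6TranslateTorusV1L0 (isTr_domT_chart)
open B6Prop26KLevelSkeletonV1L0 (hB zB ST pref)

variable (hN : ∀ μ, N0 ℓ Mh k P' μ = (PV d ℓ m K hd hL).sitesPerDir 0) {D : TDomains d ℓ Mh k P' R} (hk : k ≤ m + K)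
  (hMh1 : 1 ≤ Mh) (hP4 : ∀ μ, 4 ≤ P' μ) (c : ↥(cubes D.toDomains))

/-- **THE GLOBAL BAND GIVES THE MEMBER BAND OF EVERY CUBE** with `[a₀, a₁] := [b₀/L, b₁·L^d]`: on the index bonds of levels `j₀, j₀ + 1` the pulled-back
weight over `(c′/L^{j₀})²` lies in `[b₀/L, b₁L^d]·(L^{j₀})^{d+1}` (level `j₀ + 1` costs the factor `L^{(d+1)−2}`).
[cite: Balaban1984PropagatorsII, (2.16) p.225, (2.90) p.239, bookkeeping] -/
theorem band_of_global {b₀ b₁ cf : ℝ} (hb₀ : 0 ≤ b₀) (hcf : cf ≠ 0) (w : BondIdx (domT hN D hk) → ℝ) (hwb : GlobalBand b₀ b₁ cf w)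
    (i : BondIdx (domT hN (D.chart (svec ℓ k c.1.1 c.1.2)) hk)) (hi : (i.1.1 : ℕ) = j0 hMh1 hP4 c ∨ (i.1.1 : ℕ) = j0 hMh1 hP4 c + 1) :
    b₀ / ((ℓ + 1 : ℕ) : ℝ) * ((((ℓ + 1 : ℕ) : ℝ)) ^ j0 hMh1 hP4 c) ^ (d + 1) ≤ wC hN hk c w i / (cf / (((ℓ + 1 : ℕ) : ℝ) ^ j0 hMh1 hP4 c)) ^ 2 ∧
      wC hN hk c w i / (cf / (((ℓ + 1 : ℕ) : ℝ) ^ j0 hMh1 hP4 c)) ^ 2 ≤ b₁ * (((ℓ + 1 : ℕ) : ℝ)) ^ d * ((((ℓ + 1 : ℕ) : ℝ)) ^ j0 hMh1 hP4 c) ^ (d + 1) := by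
  have hw := hwb ((isTr_domT_chart hN D hk (svec ℓ k c.1.1 c.1.2)).idxB i)
  rw [IsTr.idxB_fst] at hw
  have ew : wC hN hk c w i = w ((isTr_domT_chart hN D hk (svec ℓ k c.1.1 c.1.2)).idxB i) := rfl
  rw [ew]
  set v := w ((isTr_domT_chart hN D hk (svec ℓ k c.1.1 c.1.2)).idxB i) with hv
  set Lr : ℝ := ((ℓ + 1 : ℕ) : ℝ) with hLr
  have hL1 : (1 : ℝ) ≤ Lr := by rw [hLr]; exact_mod_cast Nat.succ_pos ℓ
  have hL0 : (0 : ℝ) < Lr := by linarith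
  have hX : (0 : ℝ) < (Lr ^ j0 hMh1 hP4 c) ^ (d + 1) := by positivity
  have hLd : (1 : ℝ) ≤ Lr ^ d := one_le_pow₀ hL1
  rcases hi with h | h
  · rw [h] at hw
    obtain ⟨h1, h2⟩ := hw
    have hb₁ : b₀ ≤ b₁ := le_of_mul_le_mul_right (h1.trans h2) hX
    constructor
    · refine le_trans ?_ h1
      have : b₀ / Lr ≤ b₀ := div_le_self hb₀ hL1
      exact mul_le_mul_of_nonneg_right this (le_of_lt hX)
    · refine h2.trans (mul_le_mul_of_nonneg_right ?_ (le_of_lt hX))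
      have : (0 : ℝ) ≤ b₁ := hb₀.trans hb₁
      nlinarith
  · rw [h] at hw
    obtain ⟨h1, h2⟩ := hw
    -- the two denominators differ by `L²`; the two reference volumes by `L^{d+1}`
    have e1 : (cf / Lr ^ j0 hMh1 hP4 c) ^ 2 = (cf / Lr ^ (j0 hMh1 hP4 c + 1)) ^ 2 * Lr ^ 2 := by
      rw [pow_succ]; field_simp; ring
    have e2 : (Lr ^ (j0 hMh1 hP4 c + 1)) ^ (d + 1) = (Lr ^ j0 hMh1 hP4 c) ^ (d + 1) * Lr ^ (d + 1) := by
      rw [← mul_pow, ← pow_succ]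
    have hq : (0 : ℝ) < (cf / Lr ^ (j0 hMh1 hP4 c + 1)) ^ 2 := by positivity
    have hX1 : (0 : ℝ) < (Lr ^ (j0 hMh1 hP4 c + 1)) ^ (d + 1) := by positivity
    have hb₁ : b₀ ≤ b₁ := le_of_mul_le_mul_right (h1.trans h2) hX1
    have hb₁0 : (0 : ℝ) ≤ b₁ := hb₀.trans hb₁
    rw [e2] at h1 h2
    rw [e1, div_mul_eq_div_div]
    have hL2 : (0 : ℝ) < Lr ^ 2 := by positivity
    constructor
    · rw [le_div_iff₀ hL2]
      refine le_trans ?_ h1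
      have : b₀ / Lr * (Lr ^ j0 hMh1 hP4 c) ^ (d + 1) * Lr ^ 2 = b₀ * ((Lr ^ j0 hMh1 hP4 c) ^ (d + 1) * Lr ^ (0 + 1)) := by
        rw [zero_add, pow_one]; field_simp
      rw [this]
      refine mul_le_mul_of_nonneg_left (mul_le_mul_of_nonneg_left (pow_le_pow_right₀ hL1 (by omega)) (le_of_lt hX)) hb₀
    · rw [div_le_iff₀ hL2]
      refine h2.trans ?_
      have : b₁ * Lr ^ d * (Lr ^ j0 hMh1 hP4 c) ^ (d + 1) * Lr ^ 2 = b₁ * ((Lr ^ j0 hMh1 hP4 c) ^ (d + 1) * Lr ^ (d + 2)) := by ring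
      rw [this]
      exact mul_le_mul_of_nonneg_left (mul_le_mul_of_nonneg_left (pow_le_pow_right₀ hL1 (by omega)) (le_of_lt hX)) hb₁0

open Classical in
/-- **PROPOSITION 2.6, ENTRY (2.136)₁, k LEVELS, WITH THE MEMBERS OF THE CUBES AND PRINT'S WEIGHT BAND**: `prop26_2136_kLevel_cubes` with the per-cube
chart-frame band replaced by the GLOBAL band `GlobalBand b₀ b₁ c′ w` of the weights of `Δ_a` (members built with `[a₀, a₁] := [b₀/L, b₁L^d]`).
What stays displayed: `Placed` (top cubes), `Nov`, the (2.134) data of the (2.91)-family of these members, the Lemma-2.1 budget.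
[cite: Balaban1984PropagatorsII, Prop. 2.6 (2.136) p.247, (2.16) p.225, (2.89)–(2.94) p.239, (2.133)–(2.134) p.247] -/
theorem prop26_2136_kLevel_cubes_band (d ℓ : ℕ) (hd : 1 ≤ d + 1) (hL : Odd (ℓ + 1) ∧ 1 < ℓ + 1) {b₀ b₁ : ℝ} (hb₀ : 0 < b₀) (hb₁ : b₀ ≤ b₁) :
    ∃ δ : ℝ, 0 < δ ∧ ∃ A : ℝ, 0 ≤ A ∧ ∀ (m K : ℕ) {Mh k R : ℕ} {P' : Fin (d + 1) → ℕ}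
      (hN : ∀ μ, N0 ℓ Mh k P' μ = (PV d ℓ m K hd hL).sitesPerDir 0) (D : TDomains d ℓ Mh k P' R) (hk : k ≤ m + K) (_ : 2 ≤ k)
      {a : ℕ} (hMha : Mh = (ℓ + 1) ^ a) (hM8 : 8 ≤ Mh) (_ : 2 * (ℓ + 1) ^ 2 ≤ R) (hP5 : ∀ μ, 5 ≤ P' μ)
      (hpl : ∀ c : ↥(cubes D.toDomains), Placed ℓ k P' c.1)
      (α : ℝ) (_ : 0 ≤ α) (_ : α ≤ 1) (N₀ : ℕ) (_ : 0 < N₀) (_ : N₀ + 1 ≤ R * ((ℓ + 1) * Mh))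
      (_ : Real.exp (-(α * (δ / (d + 1)))) * ((ℓ : ℝ) + 1) ^ ((2 * (d + 1 : ℕ) : ℝ) / N₀) < 1)
      {cf : ℝ} (hcf : cf ≠ 0) {w : BondIdx (domT hN D hk) → ℝ} (hw : ∀ i, 0 < w i) (_ : GlobalBand b₀ b₁ cf w)
      (Nov : ℕ) (_ : ∀ y : (geomT D).Site, (Finset.univ.filter fun c : ↥(cubes D.toDomains) =>
        y ∈ ST D (one_le_of_eight_le hM8) (four_le_of_five_le hP5) c).card ≤ Nov)
      (θ₀ : ℝ) (_ : 0 ≤ θ₀)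
      (_ : ∀ c c', HasMajorant (g := geomT D) (blkV1 hN D)
        ((kFam (onFun (dE (P := PV d ℓ m K hd hL) cf ∘ₗ (LinearMap.id - RE (domT hN D hk) cf) ∘ₗ dsE cf))
            (fun c => mulOp (hB hN D c)) (fun c => mulOp (zB hN D (one_le_of_eight_le hM8) (four_le_of_five_le hP5) c))
            (fun c => Ml hN hk (one_le_of_eight_le hM8) (four_le_of_five_le hP5) hMha c (band_le (d := d) (ℓ := ℓ) hb₀ hb₁) (hpl c) w cf)
            (fun c => Pl hN hk (one_le_of_eight_le hM8) (four_le_of_five_le hP5) hMha c (band_le (d := d) (ℓ := ℓ) hb₀ hb₁) (hpl c) w cf) c c' *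
          Gl hN hk (one_le_of_eight_le hM8) (four_le_of_five_le hP5) hMha c' (band_le (d := d) (ℓ := ℓ) hb₀ hb₁) (hpl c') w cf) *
          mulOp (hB hN D c'))
        (fun y y' => θ₀ * Real.exp (-((2 * (δ / (d + 1))) / 2 * (geomT D).dist y y'))))
      (_ : ∀ c c', OutLoc (g := geomT D) (blkV1 hN D)
        (kFam (onFun (dE (P := PV d ℓ m K hd hL) cf ∘ₗ (LinearMap.id - RE (domT hN D hk) cf) ∘ₗ dsE cf))
            (fun c => mulOp (hB hN D c)) (fun c => mulOp (zB hN D (one_le_of_eight_le hM8) (four_le_of_five_le hP5) c))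
            (fun c => Ml hN hk (one_le_of_eight_le hM8) (four_le_of_five_le hP5) hMha c (band_le (d := d) (ℓ := ℓ) hb₀ hb₁) (hpl c) w cf)
            (fun c => Pl hN hk (one_le_of_eight_le hM8) (four_le_of_five_le hP5) hMha c (band_le (d := d) (ℓ := ℓ) hb₀ hb₁) (hpl c) w cf) c c' *
          Gl hN hk (one_le_of_eight_le hM8) (four_le_of_five_le hP5) hMha c' (band_le (d := d) (ℓ := ℓ) hb₀ hb₁) (hpl c') w cf)
        (ST D (one_le_of_eight_le hM8) (four_le_of_five_le hP5) c))
      (_ : (Nov : ℝ) ^ 2 * θ₀ * K261 N₀ (d + 1) ((ℓ : ℝ) + 1) 1 (α * (δ / (d + 1))) < 1),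
      HasMajorant (g := geomT D) (blkV1 hN D) (onFun (GE (domT hN D hk) hcf hw))
        (fun y y' => (Nov * A) * K261 N₀ (d + 1) ((ℓ : ℝ) + 1) 1 (α * (δ / (d + 1))) *
          (1 - (Nov : ℝ) ^ 2 * θ₀ * K261 N₀ (d + 1) ((ℓ : ℝ) + 1) 1 (α * (δ / (d + 1))))⁻¹ * pref cf y *
          Real.exp (-(delta3 α (2 * (δ / (d + 1))) * (geomT D).dist y y'))) := by
  obtain ⟨δ, hδ, A, hA, h⟩ := prop26_2136_kLevel_cubes d ℓ hd hL (a₀ := b₀ / ((ℓ + 1 : ℕ) : ℝ)) (a₁ := b₁ * (((ℓ + 1 : ℕ) : ℝ)) ^ d)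
    (by positivity) (band_le hb₀ hb₁)
  refine ⟨δ, hδ, A, hA, ?_⟩
  intro m K Mh k R P' hN D hk hk2 a hMha hM8 hR2 hP5 hpl α hα0 hα1 N₀ hN₀ hRM hθ cf hcf w hw hwb Nov hNov θ₀ hθ₀ h2134 hKout hsmall
  exact h m K hN D hk hk2 hMha hM8 hR2 hP5 hpl α hα0 hα1 N₀ hN₀ hRM hθ hcf hw
    (fun c i hi _ => band_of_global hN hk (one_le_of_eight_le hM8) (four_le_of_five_le hP5) c (le_of_lt hb₀) hcf w hwb i hi)
    Nov hNov θ₀ hθ₀ h2134 hKout hsmall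

end Band

/-! ## §9  (v1.2) The overlap number `Nov` DISCHARGED (p21's torus cover count); every cube placed at `L = 5`, `P′ ≥ 12` -/

section Overlap

open B6SectAOperatorsV1 (dE dsE dcE dcsE QE aE QsE RE BondIdx)
open B6SectAVectorModelV1 (GE)
open B6Prop26Gluing (mulOp LocalMajorant OutLoc)
open B6Ineq2133TwoScaleV1 (onFun)
open B6RandomWalk (HasMajorant delta3)
open B6Ineq261LevelGap (K261)
open B6Eq291Generator (kFam)
open B6Geom246MultiLevelTorusL0 (geomT)
open B6Prop26KLevelSkeletonV1L0 (hB zB ST mem_ST pref)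
open B6Partition118KLevelTorusCentralL0 (QT)
open B6Cover236MultiLevelTorusReachL0 (card_filter_mem_QT_le)

variable {D : TDomains d ℓ Mh k P' R} (hMh1 : 1 ≤ Mh) (hP4 : ∀ μ, 4 ≤ P' μ)

/-- **THE OVERLAP NUMBER OF THE REACH SETS `Q^T_□` IS `3·5^{d+1}`** — the hypothesis `hNov` of `prop26_2136_kLevel_cubes(_band)` DISCHARGED by p21's
`B6Cover236MultiLevelTorusReachL0.card_filter_mem_QT_le` (`M_h ≥ 2`, `R ≥ 2L`; `ST = ↑QT`). [cite: Balaban1984PropagatorsII, (2.36) p.229 («each cube being a sum of 2^d big blocks»), p.235] -/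
theorem hNov_cover (hMh : 2 ≤ Mh) (hR : 2 * (ℓ + 1) ≤ R) [∀ (y : (B6Geom246MultiLevelTorusL0.geomT D).Site) (c : ↥(cubes D.toDomains)), Decidable (y ∈ ST D hMh1 hP4 c)] :
    ∀ y : (geomT D).Site, (Finset.univ.filter fun c : ↥(cubes D.toDomains) => y ∈ ST D hMh1 hP4 c).card ≤ 3 * 5 ^ (d + 1) := by
  classical
  intro y
  have h := card_filter_mem_QT_le (D := D) hMh hR hMh1 hP4 y
  have e : (Finset.univ.filter fun c : ↥(cubes D.toDomains) => y ∈ ST D hMh1 hP4 c) =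
      (Finset.univ.filter fun c : ↥(cubes D.toDomains) => y ∈ QT D hMh1 hP4 c) := by
    ext c
    simp only [Finset.mem_filter, mem_ST]
  rw [e]
  exact h

/-- every cube of the cover is placed at `L = 5`, `P′ ≥ 12`. [cite: Balaban1984PropagatorsII, p.229, dictionary (charts)] -/
theorem placed_all_cubes (hℓ : ℓ = 4) (hP : ∀ μ, 12 ≤ P' μ) : ∀ c : ↥(B6Cover236MultiLevelBlocksL0.cubes D.toDomains), Placed ℓ k P' c.1 :=
  fun c => placed_all hℓ hP c.1 (level_bounds D.toDomains c).2

open Classical in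
/-- **PROPOSITION 2.6, ENTRY (2.136)₁, k LEVELS — THE BAND THEOREM WITH THE OVERLAP NUMBER DISCHARGED** (`Nov = 3·5^{d+1}`, `hNov_cover`): as
`prop26_2136_kLevel_cubes_band`; displayed stay `Placed` (all cubes — automatic at `L = 5`, `P′ ≥ 12`: `placed_all_cubes`), the (2.134) data of the
(2.91)-family of the members, the Lemma-2.1 budget. [cite: Balaban1984PropagatorsII, Prop. 2.6 (2.136) p.247, (2.16) p.225, (2.89)–(2.94) p.239, (2.133)–(2.134) p.247, (2.36) p.229] -/
theorem prop26_2136_kLevel_cubes_band_nov (d ℓ : ℕ) (hd : 1 ≤ d + 1) (hL : Odd (ℓ + 1) ∧ 1 < ℓ + 1) {b₀ b₁ : ℝ} (hb₀ : 0 < b₀) (hb₁ : b₀ ≤ b₁) :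
    ∃ δ : ℝ, 0 < δ ∧ ∃ A : ℝ, 0 ≤ A ∧ ∀ (m K : ℕ) {Mh k R : ℕ} {P' : Fin (d + 1) → ℕ}
      (hN : ∀ μ, N0 ℓ Mh k P' μ = (PV d ℓ m K hd hL).sitesPerDir 0) (D : TDomains d ℓ Mh k P' R) (hk : k ≤ m + K) (_ : 2 ≤ k)
      {a : ℕ} (hMha : Mh = (ℓ + 1) ^ a) (hM8 : 8 ≤ Mh) (_ : 2 * (ℓ + 1) ^ 2 ≤ R) (hP5 : ∀ μ, 5 ≤ P' μ)
      (hpl : ∀ c : ↥(cubes D.toDomains), Placed ℓ k P' c.1)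
      (α : ℝ) (_ : 0 ≤ α) (_ : α ≤ 1) (N₀ : ℕ) (_ : 0 < N₀) (_ : N₀ + 1 ≤ R * ((ℓ + 1) * Mh))
      (_ : Real.exp (-(α * (δ / (d + 1)))) * ((ℓ : ℝ) + 1) ^ ((2 * (d + 1 : ℕ) : ℝ) / N₀) < 1)
      {cf : ℝ} (hcf : cf ≠ 0) {w : BondIdx (domT hN D hk) → ℝ} (hw : ∀ i, 0 < w i) (_ : GlobalBand b₀ b₁ cf w)
      (θ₀ : ℝ) (_ : 0 ≤ θ₀)
      (_ : ∀ c c', HasMajorant (g := geomT D) (blkV1 hN D)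
        ((kFam (onFun (dE (P := PV d ℓ m K hd hL) cf ∘ₗ (LinearMap.id - RE (domT hN D hk) cf) ∘ₗ dsE cf))
            (fun c => mulOp (hB hN D c)) (fun c => mulOp (zB hN D (one_le_of_eight_le hM8) (four_le_of_five_le hP5) c))
            (fun c => Ml hN hk (one_le_of_eight_le hM8) (four_le_of_five_le hP5) hMha c (band_le (d := d) (ℓ := ℓ) hb₀ hb₁) (hpl c) w cf)
            (fun c => Pl hN hk (one_le_of_eight_le hM8) (four_le_of_five_le hP5) hMha c (band_le (d := d) (ℓ := ℓ) hb₀ hb₁) (hpl c) w cf) c c' *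
          Gl hN hk (one_le_of_eight_le hM8) (four_le_of_five_le hP5) hMha c' (band_le (d := d) (ℓ := ℓ) hb₀ hb₁) (hpl c') w cf) *
          mulOp (hB hN D c'))
        (fun y y' => θ₀ * Real.exp (-((2 * (δ / (d + 1))) / 2 * (geomT D).dist y y'))))
      (_ : ∀ c c', OutLoc (g := geomT D) (blkV1 hN D)
        (kFam (onFun (dE (P := PV d ℓ m K hd hL) cf ∘ₗ (LinearMap.id - RE (domT hN D hk) cf) ∘ₗ dsE cf))
            (fun c => mulOp (hB hN D c)) (fun c => mulOp (zB hN D (one_le_of_eight_le hM8) (four_le_of_five_le hP5) c))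
            (fun c => Ml hN hk (one_le_of_eight_le hM8) (four_le_of_five_le hP5) hMha c (band_le (d := d) (ℓ := ℓ) hb₀ hb₁) (hpl c) w cf)
            (fun c => Pl hN hk (one_le_of_eight_le hM8) (four_le_of_five_le hP5) hMha c (band_le (d := d) (ℓ := ℓ) hb₀ hb₁) (hpl c) w cf) c c' *
          Gl hN hk (one_le_of_eight_le hM8) (four_le_of_five_le hP5) hMha c' (band_le (d := d) (ℓ := ℓ) hb₀ hb₁) (hpl c') w cf)
        (ST D (one_le_of_eight_le hM8) (four_le_of_five_le hP5) c))
      (_ : ((3 * 5 ^ (d + 1) : ℕ) : ℝ) ^ 2 * θ₀ * K261 N₀ (d + 1) ((ℓ : ℝ) + 1) 1 (α * (δ / (d + 1))) < 1),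
      HasMajorant (g := geomT D) (blkV1 hN D) (onFun (GE (domT hN D hk) hcf hw))
        (fun y y' => ((3 * 5 ^ (d + 1) : ℕ) * A) * K261 N₀ (d + 1) ((ℓ : ℝ) + 1) 1 (α * (δ / (d + 1))) *
          (1 - ((3 * 5 ^ (d + 1) : ℕ) : ℝ) ^ 2 * θ₀ * K261 N₀ (d + 1) ((ℓ : ℝ) + 1) 1 (α * (δ / (d + 1))))⁻¹ * pref cf y *
          Real.exp (-(delta3 α (2 * (δ / (d + 1))) * (geomT D).dist y y'))) := by
  obtain ⟨δ, hδ, A, hA, h⟩ := prop26_2136_kLevel_cubes_band d ℓ hd hL hb₀ hb₁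
  refine ⟨δ, hδ, A, hA, ?_⟩
  intro m K Mh k R P' hN D hk hk2 a hMha hM8 hR2 hP5 hpl α hα0 hα1 N₀ hN₀ hRM hθ cf hcf w hw hwb θ₀ hθ₀ h2134 hKout hsmall
  have hMh : 2 ≤ Mh := le_trans (by norm_num) hM8
  have hR : 2 * (ℓ + 1) ≤ R := le_trans (by nlinarith : 2 * (ℓ + 1) ≤ 2 * (ℓ + 1) ^ 2) hR2
  exact h m K hN D hk hk2 hMha hM8 hR2 hP5 hpl α hα0 hα1 N₀ hN₀ hRM hθ hcf hw hwb (3 * 5 ^ (d + 1))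
    (hNov_cover (one_le_of_eight_le hM8) (four_le_of_five_le hP5) hMh hR) θ₀ hθ₀ h2134 hKout hsmall

end Overlap

end Literature.MathematicalPhysics.QuantumFieldTheory.Balaban1983to89.B6CubeWindowV1L0
end

-- L0-port marker: J7 call sites rewritten
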